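import Literature.MathematicalPhysics.QuantumFieldTheory.Balaban1983to89.B3Ineq210RegularTorus
import Literature.MathematicalPhysics.QuantumFieldTheory.Balaban1983to89.B1Ineq224RegularTorus

/-!
# Bałaban, *(Higgs)₂,₃ quantum fields in a finite volume III. Renormalization* [B3] — (2.11) p. 426, THE HÖLDER MEMBER OF THE
SCALE PIECES, AT A REGULAR NON-CONSTANT BACKGROUND `B̃ = A` ON THE TORUS `Ω = T_η`, PROVED for a concrete carrier of
`B3Sect2StatementsPart2.ScaledKernels` (the decl of record `ScaledKernels.Ineq211At α δ₁ C` of row B3.Eq2.11 DISCHARGED per `α`)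

statement-level skeleton of published theorems with citation tags; proofs where landed; nothing here is a claim about the Yang–Mills mass gap

T. Bałaban, Commun. Math. Phys. **88** (1983) 411–445 [cite: Balaban1983Higgs3]; inputs from part I, Commun. Math. Phys. **85**
(1982) 603–636 [cite: Balaban1982Higgs1] as landed in the tree.  PDF held: `paper:balaban1983-higgs-2-3-quantum-fields-finite-volume`
(journal page = PDF page + 410), p. 426 [PDF 16]; render `run/shared/lean/pub/pub-balaban/b2b-balaban-ref1/pages/1983-cmp88-higgs23-III/
1983-cmp88-higgs23-III-p016-x2.png`.

CITATION HEADER (lean-in-tree rule).  Cell `lit-balaban` (HOME `run/shared/lean/pub/lit-balaban/`), Phase-2 proof seat **p26** gen 32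
(unit `lit-balaban-p26`); SKELETON row **B3.Eq2.11** (fold owner r15; DECL OF RECORD `B3Sect2StatementsPart2.ScaledKernels.Ineq211At`,
r15 p255002, GAPS G-B3-11: per-α constants).  COMPANION of r14 g17's `B3Ineq210RegularTorus` (p339501: (2.10) at a regular non-constant
background on `T_η` — the pieces `pieceA`, the sandwich engine, the carrier `regTorusKernels`) and the regular-background TWIN of p03's
`B3Ineq211ZeroTorus` (p259170: (2.11) at `A = B̃ = 0`).  USED BY NAME, never restated: p339501's `pieceA`/`sandwich`/`termA`,
`abs_coord_CQG_le`, `abs_mat_QG_le`, `sum3_le`, `exp_blockIter_le`, `blockDist_le_tdist`, `norm_avgQkAdj_cb_le`,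
`blockIter_eq_of_avgQkAdj_cb_ne_zero`, `reg223_of_small`, `cst210`/`ineq210_regularTorus`/`regularTorus_hypotheses_nonvacuous`; p35's
(I.2.24) Hölder clause at a regular `A` on the torus `B1Ineq224RegularTorus.norm_holder_propagatorK_reg_decay` (gen 11) with its
transport `B1TorusChainTransport.hol` along nearest-neighbour chains (`IsTChain`, `B4GaugeCovariance.pathEnd`); p35's (I.2.25) value
clause `B1Ineq225RegularTorus.norm_propagatorK_reg_decay`; r14's (I.2.34) `B1Props21to23RegularTorus.ineq234_236_regular_torus_std`.

## What is printed (p. 426 [PDF 16], verbatim)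

*"This applies also to Hölder norms, e.g. we have
(1/|x₂−x₁|^α)|U(B̃(Γ_{x₁,x₂}))(D^η_{B̃,μ}G^η_{(j)})(Ω,B̃;x₂,x) − (D^η_{B̃,μ}G^η_{(j)})(Ω,B̃;x₁,x)| ≤ O(1)(L^jη)^{−d+1−α}e^{−δ₁(L^jη)^{−1}dist({x₁,x₂},x)},
0 ≤ α < 1. (2.11) … These inequalities will be used in the next chapter. They all are obtained by rescaling from the η-lattice to the
L^{−j}-lattice and application of Propositions I.2.1 and I.2.3."*  [B1] p. 610 [PDF 8]: *"let us denote yb [sic] Γ_{x,x′} a shortest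
contour connecting these points"*, (2.24).

## What this file proves (`ineq211At_regularTorus`), and how

The decl of record `ScaledKernels.Ineq211At α δ₁ C` for the concrete carrier `regTorusKernelsH S C A m² a k` (= p339501's
`regTorusKernels` with the two (2.11) fields modelled) at a `δ_A`-regular, non-constant `u(N)`-background `A`, `Ω = T_η`, at EVERY
fixed Hölder exponent `0 ≤ α < 1`, constants uniform in the volume, the scale and `A` (per `α` and per cube size `K₀`, as the inputs).
Route = the print's: each piece `G^η_{(j)} = a_j²(L^jε)^{−4}G^ε_jQ_j^*C^{(j)}Q_jG^ε_j` (`1 ≤ j < k`; `G^η_{(0)} = G^ε_1`) has its transported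
Hölder difference in the ROW variable falling on the FIRST factor `G^ε_j(T_ε, A)`, bounded by Proposition I.2.1 (2.24) at a regular `A`
on the torus (p35's theorem, weight `(|x₁ − x₂|/L^j)^{−α}` on the left); the remaining factors are bounded exactly as in p339501 ((I.2.25)
value clause for `Q_jG^ε_j` by adjointness, (I.2.34) for `C^{(j)}`, the three-kernel convolution `sum3_le` — run twice, once from `x₁`
and once from `x₂`, since the decay of (2.24) is from the pair `{x₁, x₂}`); the scaling
`ε^{−d}a_j²(L^jε)^{−4}(L^jε)^{1+2+2}L^{−jd}·(|x₁−x₂|/L^j)^α/|x₁−x₂|^α = a_j²(L^jε)^{1−d−α}` (`|x₁ − x₂| = ε·t` in ε-units) is the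
print's «rescaling from the η-lattice to the L^{−j}-lattice».  §0 admissible contours and the algebra of the transported difference
(coordinate expansion through the linear `U(A(Γ))` and `D^ε_A`); §1 the Hölder engine (`holder_G_avgQkAdj_cb_le`, `holder_sandwich_cb_le`);
§2 the pieces (`holderTerm`, `holder_piece_zero_le`, `holder_piece_pos_le`); §3 the carrier `regTorusKernelsH`, `ineq210_iff_H`,
`holderTerm_le_holderDiff`, the transfer `ineq211At_of_bounds`; §4 the theorem `ineq211At_regularTorus`, (2.10) ∧ (2.11) on the same
carrier (`ineq210_and_211At_regularTorusH`); non-vacuity: `exists_isAdm` (admissible contours exist for every pair) and p339501's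
`regularTorus_hypotheses_nonvacuous` (the hypotheses on `K₀`, the volume and `A = 0`).

## Dictionary and honest scope

As p339501 (`T_η := Site P 0`, `η = ε`, `dist x x′ = ε|x − x′|` with the sup torus distance (I.1.3), column-sum norm over the source
colour of the `N × N` block kernels, covariant derivative (I.1.7) in the row variable).  The Hölder field: `holderDiff j μ x₁ x₂ x :=
sup over the ADMISSIBLE CONTOURS Γ from x₁ to x₂` (nearest-neighbour chains with `|Γ| ≤ d·|x₁ − x₂|` — the reading of «a shortest
contour» of p35's (I.2.24) theorem and of r01's typed `lhs19`) of
`ε^{−d}Σ_{i′}‖U(A(Γ))(D^ε_{A,μ}G^η_{(j)}e_{(x,i′)})(x₂) − (D^ε_{A,μ}G^η_{(j)}e_{(x,i′)})(x₁)‖`; every admissible contour's transported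
difference is dominated (`holderTerm_le_holderDiff`); `dist2 x₁ x₂ x = ε·min(|x₁ − x|, |x₂ − x|) = dist({x₁,x₂}, x)`.  The supremum
over the admissible T-chains REALISES the print's `U(B̃(Γ_{x₁,x₂}))` — «Γ_{x,x′} a shortest contour connecting these points» [B1]
p. 610, «where Γ_{x,x′} is a shortest contour connecting x and x′» [B3] (1.32) p. 420 — read as a nearest-neighbour contour from `x₁`
to `x₂` of length `≤ d·|x₁ − x₂|`: every shortest contour is
admissible (its length is the ℓ¹-distance `≤ d·` the (I.1.3) sup-distance), and admissible contours exist for every pair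
(`exists_isAdm`), so the bound holds in particular for the printed left side with any choice of shortest contour.  p339501's
`regTorusKernels` sets the (2.5)/(2.11)/(2.12) fields to `0` BY CONSTRUCTION (its docstring: those fields «are NOT modelled (set to
`0`; nothing is claimed about them)») — `Ineq211At` is simply not a statement about that carrier, exactly as p03's `zeroTorusKernels`
vs `zeroTorusKernelsH`; this file EXTENDS it (`regTorusKernelsH` = the same carrier with the two (2.11) fields filled in), and since
the (2.10) clause reads only the common fields (`ineq210_iff_H`, `Iff.rfl`) p339501's `ineq210_regularTorus` applies to
`regTorusKernelsH` verbatim (`ineq210_and_211At_regularTorusH`).  NOT covered: regions `Ω ≠ T_η` ((2.5), (2.12), `∂Ω`); `m² = 0`; volumes outside the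
`Shape` sub-family or not tiled by `K₀`-cubes; the uniform-in-α `Ineq211` (GAPS G-B3-11, not printed); admissible contours EXIST for
every pair (`exists_isAdm`: the coordinatewise shortest lattice path), so the supremum is over a non-empty set.  No `… : Prop` fact,
no new named fact (`IsAdm` is a predicate with a body, `holderTerm`/`regTorusKernelsH`/`cst211` are concrete `def`s); axioms standard.
v1.0 p340301 (2026-08-22, ACCEPTED 5972d1bb3782); v1.1 DOC-ONLY (this header: the two sentences on what the supremum over admissible
contours realises and on p339501's carrier, at the B3 fold owner's request r15 g12 2026-08-22T19:58:55Z) — declarations byte-identical.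
-/

noncomputable section

open scoped BigOperators

namespace Literature.MathematicalPhysics.QuantumFieldTheory.Balaban1983to89.B3Ineq211RegularTorus

open HiggsLattice (ChargeData ScalarField covDeriv)
open HiggsCovariance (propagatorK avgQkLin avgQkAdj E)
open HiggsAveraging (blockIter)
open HiggsFluctMeasure (coeff221)
open B1Eq221Coordinates (fieldCoord)
open B1Eq230FluctCov (mat Ix cb fluctCovA cb_repr)
open B1Ineq234Concrete (profile profile_nonneg' nCol)
open B1Ineq234LevelZero (tdist_comm tdist_triangle_real)
open B1TorusChainTransport (IsTChain TNbr hol norm_hol_apply)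
open B4GaugeCovariance (pathEnd)
open B3Sect2StatementsPart2 (ScaledKernels)
open B1Eq211ZeroFieldTorus (Shape)
open B3Ineq210RegularTorus

variable {P : HiggsLattice.Params} {N : ℕ}

/-! ## §0 Admissible contours and the algebra of the transported difference `U(A(Γ))w(x₂) − w(x₁)` -/

section Algebra

/-- **Admissible contours `Γ_{x₁,x₂}`** (*"a shortest contour connecting these points"*, [B1] p. 610, read as in p35's
`B1Ineq224RegularTorus`: a nearest-neighbour chain on `T_ε` from `x₁` to `x₂` with `|Γ| ≤ d·|x₁ − x₂|`).
[cite: Balaban1982Higgs1, Prop. 2.1 p.610] -/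
def IsAdm (x₁ x₂ : HiggsLattice.Site P 0) (Γ : List (HiggsLattice.Site P 0)) : Prop :=
  IsTChain x₁ Γ ∧ pathEnd x₁ Γ = x₂ ∧ (Γ.length : ℝ) ≤ (P.d : ℝ) * HiggsLattice.Site.tdist x₁ x₂

/-- distinct torus sites are at (1.3)-distance at least one lattice unit. [cite: Balaban1982Higgs1, (1.3) p.604] -/
theorem one_le_tdist_of_ne' {k : ℕ} {x x' : HiggsLattice.Site P k} (h : x' ≠ x) : 1 ≤ HiggsLattice.Site.tdist x x' := by
  obtain ⟨μ, hμ⟩ : ∃ μ, x' μ ≠ x μ := by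
    by_contra hc
    push Not at hc
    exact h (funext hc)
  unfold HiggsLattice.Site.tdist
  refine le_trans ?_ (Finset.le_sup (f := fun ν : Fin P.d => min (x ν - x' ν).val (x' ν - x ν).val) (Finset.mem_univ μ))
  refine le_min ?_ ?_
  · exact Nat.one_le_iff_ne_zero.2 fun h0 => hμ (sub_eq_zero.1 ((ZMod.val_eq_zero _).1 h0)).symm
  · exact Nat.one_le_iff_ne_zero.2 fun h0 => hμ (sub_eq_zero.1 ((ZMod.val_eq_zero _).1 h0))

/-! ### Existence of admissible contours: the coordinatewise shortest lattice path

For every pair `x₁, x₂ ∈ T_ε` a nearest-neighbour chain from `x₁` to `x₂` of length `Σ_μ dist_μ(x₁,x₂) ≤ d·|x₁ − x₂|` (walk each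
coordinate along its shorter arc) — so the supremum defining `holderDiff` is over a non-empty set and «a shortest contour» is admissible. -/

/-- `n` forward steps in direction `μ`: `x + εe_μ, x + 2εe_μ, …, x + nεe_μ`. [cite: Balaban1982Higgs1, (1.2) p.604] -/
def stepsFwd (μ : Fin P.d) : HiggsLattice.Site P 0 → ℕ → List (HiggsLattice.Site P 0)
  | _, 0 => []
  | x, n + 1 => x.shift μ :: stepsFwd μ (x.shift μ) n

/-- `n` backward steps in direction `μ`. [cite: Balaban1982Higgs1, (1.2) p.604] -/
def stepsBwd (μ : Fin P.d) : HiggsLattice.Site P 0 → ℕ → List (HiggsLattice.Site P 0)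
  | _, 0 => []
  | x, n + 1 => x.unshift μ :: stepsBwd μ (x.unshift μ) n

/-- forward steps form a chain. [cite: Balaban1983RegularityDecay, p.572] -/
theorem isTChain_stepsFwd (μ : Fin P.d) : ∀ (x : HiggsLattice.Site P 0) (n : ℕ), IsTChain x (stepsFwd μ x n)
  | _, 0 => trivial
  | x, n + 1 => ⟨⟨μ, Or.inl rfl⟩, isTChain_stepsFwd μ (x.shift μ) n⟩

/-- backward steps form a chain. [cite: Balaban1983RegularityDecay, p.572] -/
theorem isTChain_stepsBwd (μ : Fin P.d) : ∀ (x : HiggsLattice.Site P 0) (n : ℕ), IsTChain x (stepsBwd μ x n)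
  | _, 0 => trivial
  | x, n + 1 => ⟨⟨μ, Or.inr (HiggsCovariancePos.shift_unshift x μ).symm⟩, isTChain_stepsBwd μ (x.unshift μ) n⟩

/-- `n` forward steps have length `n`. [folklore] -/
private theorem length_stepsFwd (μ : Fin P.d) : ∀ (x : HiggsLattice.Site P 0) (n : ℕ), (stepsFwd μ x n).length = n
  | _, 0 => rfl
  | x, n + 1 => by rw [stepsFwd, List.length_cons, length_stepsFwd μ (x.shift μ) n]

/-- `n` backward steps have length `n`. [folklore] -/
private theorem length_stepsBwd (μ : Fin P.d) : ∀ (x : HiggsLattice.Site P 0) (n : ℕ), (stepsBwd μ x n).length = n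
  | _, 0 => rfl
  | x, n + 1 => by rw [stepsBwd, List.length_cons, length_stepsBwd μ (x.unshift μ) n]

/-- the end point of `n` forward steps: the `μ`-th label advanced by `n`. [cite: Balaban1982Higgs1, (1.2) p.604] -/
theorem pathEnd_stepsFwd (μ : Fin P.d) : ∀ (x : HiggsLattice.Site P 0) (n : ℕ),
    pathEnd x (stepsFwd μ x n) = Function.update x μ (x μ + n)
  | x, 0 => by simp [stepsFwd, pathEnd]
  | x, n + 1 => by
    rw [stepsFwd, pathEnd, pathEnd_stepsFwd μ (x.shift μ) n]
    simp only [HiggsLattice.Site.shift, Function.update_idem, Function.update_self, Nat.cast_succ]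
    congr 1; ring

/-- the end point of `n` backward steps: the `μ`-th label decreased by `n`. [cite: Balaban1982Higgs1, (1.2) p.604] -/
theorem pathEnd_stepsBwd (μ : Fin P.d) : ∀ (x : HiggsLattice.Site P 0) (n : ℕ),
    pathEnd x (stepsBwd μ x n) = Function.update x μ (x μ - n)
  | x, 0 => by simp [stepsBwd, pathEnd]
  | x, n + 1 => by
    rw [stepsBwd, pathEnd, pathEnd_stepsBwd μ (x.unshift μ) n]
    simp only [HiggsLattice.Site.unshift, Function.update_idem, Function.update_self, Nat.cast_succ]
    congr 1; ring

/-- chains concatenate: end points compose. [folklore] -/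
private theorem pathEnd_append' (x : HiggsLattice.Site P 0) :
    ∀ l₁ l₂ : List (HiggsLattice.Site P 0), pathEnd x (l₁ ++ l₂) = pathEnd (pathEnd x l₁) l₂
  | [], _ => rfl
  | y :: l₁, l₂ => by rw [List.cons_append, pathEnd, pathEnd, pathEnd_append' y l₁ l₂]

/-- chains concatenate. [cite: Balaban1983RegularityDecay, p.572] -/
theorem isTChain_append' : ∀ (x : HiggsLattice.Site P 0) (l₁ l₂ : List (HiggsLattice.Site P 0)),
    IsTChain x l₁ → IsTChain (pathEnd x l₁) l₂ → IsTChain x (l₁ ++ l₂)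
  | _, [], _, _, h₂ => h₂
  | _, y :: l₁, l₂, h₁, h₂ => ⟨h₁.1, isTChain_append' y l₁ l₂ h₁.2 h₂⟩

/-- ONE LEG: walk coordinate `μ` from `x μ` to `y μ` along the shorter arc of the cycle. [cite: Balaban1982Higgs1, (1.3) p.604] -/
def leg (x y : HiggsLattice.Site P 0) (μ : Fin P.d) : List (HiggsLattice.Site P 0) :=
  if (y μ - x μ).val ≤ (x μ - y μ).val then stepsFwd μ x (y μ - x μ).val else stepsBwd μ x (x μ - y μ).val

/-- a leg is a chain. [cite: Balaban1983RegularityDecay, p.572] -/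
theorem isTChain_leg (x y : HiggsLattice.Site P 0) (μ : Fin P.d) : IsTChain x (leg x y μ) := by
  unfold leg; split_ifs
  · exact isTChain_stepsFwd μ x _
  · exact isTChain_stepsBwd μ x _

/-- a leg ends with the `μ`-th label set to `y μ`. [cite: Balaban1982Higgs1, (1.2) p.604] -/
theorem pathEnd_leg (x y : HiggsLattice.Site P 0) (μ : Fin P.d) : pathEnd x (leg x y μ) = Function.update x μ (y μ) := by
  unfold leg; split_ifs
  · rw [pathEnd_stepsFwd, ZMod.natCast_zmod_val]; congr 1; abel
  · rw [pathEnd_stepsBwd, ZMod.natCast_zmod_val]; congr 1; abel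

/-- a leg has the length of the shorter arc, `dist_μ(x, y) = min{(y_μ − x_μ) mod, (x_μ − y_μ) mod}`. [cite: Balaban1982Higgs1, (1.3) p.604] -/
theorem length_leg (x y : HiggsLattice.Site P 0) (μ : Fin P.d) :
    (leg x y μ).length = min (x μ - y μ).val (y μ - x μ).val := by
  unfold leg; split_ifs with h
  · rw [length_stepsFwd, min_eq_right h]
  · rw [length_stepsBwd, min_eq_left (le_of_not_ge h)]

/-- one coordinate's arc is below the (1.3)-distance. [cite: Balaban1982Higgs1, (1.3) p.604] -/
theorem coordDist_le_tdist (x y : HiggsLattice.Site P 0) (μ : Fin P.d) :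
    min (x μ - y μ).val (y μ - x μ).val ≤ HiggsLattice.Site.tdist x y :=
  Finset.le_sup (f := fun ν : Fin P.d => min (x ν - y ν).val (y ν - x ν).val) (Finset.mem_univ μ)

/-- ALL LEGS: walk the listed coordinates one after the other. [cite: Balaban1982Higgs1, (1.3) p.604] -/
def legs (y : HiggsLattice.Site P 0) : HiggsLattice.Site P 0 → List (Fin P.d) → List (HiggsLattice.Site P 0)
  | _, [] => []
  | x, μ :: ms => leg x y μ ++ legs y (Function.update x μ (y μ)) ms

/-- the legs form a chain. [cite: Balaban1983RegularityDecay, p.572] -/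
theorem isTChain_legs (y : HiggsLattice.Site P 0) : ∀ (x : HiggsLattice.Site P 0) (ms : List (Fin P.d)), IsTChain x (legs y x ms)
  | _, [] => trivial
  | x, μ :: ms => by
    rw [legs]
    refine isTChain_append' x _ _ (isTChain_leg x y μ) ?_
    rw [pathEnd_leg]
    exact isTChain_legs y _ ms

/-- the legs end at the point whose listed labels are those of `y`, the others those of `x`. [cite: Balaban1982Higgs1, (1.2) p.604] -/
theorem pathEnd_legs (y : HiggsLattice.Site P 0) : ∀ (x : HiggsLattice.Site P 0) (ms : List (Fin P.d)),
    pathEnd x (legs y x ms) = fun ν => if ν ∈ ms then y ν else x ν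
  | x, [] => by funext ν; simp [legs, pathEnd]
  | x, μ :: ms => by
    rw [legs, pathEnd_append', pathEnd_leg, pathEnd_legs y _ ms]
    funext ν
    by_cases hν : ν = μ
    · subst hν; simp
    · simp [hν]

/-- the legs from a point whose labels are each `x`'s or `y`'s have total length `≤ |ms|·|x − y|`. [cite: Balaban1982Higgs1, (1.3) p.604] -/
theorem length_legs_le (x y : HiggsLattice.Site P 0) : ∀ (x' : HiggsLattice.Site P 0) (ms : List (Fin P.d)),
    (∀ ν, x' ν = x ν ∨ x' ν = y ν) → (legs y x' ms).length ≤ ms.length * HiggsLattice.Site.tdist x y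
  | x', [], _ => by simp [legs]
  | x', μ :: ms, hx' => by
    rw [legs, List.length_append, List.length_cons, Nat.succ_mul, add_comm (ms.length * _)]
    refine Nat.add_le_add ?_ (length_legs_le x y _ ms fun ν => ?_)
    · rw [length_leg]
      rcases hx' μ with h | h
      · rw [h]; exact coordDist_le_tdist x y μ
      · rw [h, sub_self, ZMod.val_zero]; exact (min_le_left _ _).trans (Nat.zero_le _)
    · by_cases hν : ν = μ
      · subst hν; exact Or.inr (Function.update_self _ _ _)
      · rw [Function.update_of_ne hν]; exact hx' ν

/-- **Existence of admissible contours** for EVERY pair of sites of `T_ε`: the coordinatewise shortest lattice path (each label along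
its shorter arc) is a nearest-neighbour chain from `x₁` to `x₂` with `|Γ| = Σ_μ dist_μ ≤ d·|x₁ − x₂|`. [cite: Balaban1982Higgs1, Prop. 2.1 p.610] -/
theorem exists_isAdm (x₁ x₂ : HiggsLattice.Site P 0) : ∃ Γ : List (HiggsLattice.Site P 0), IsAdm x₁ x₂ Γ := by
  refine ⟨legs x₂ x₁ (List.finRange P.d), isTChain_legs x₂ x₁ _, ?_, ?_⟩
  · rw [pathEnd_legs]; funext ν; simp
  · have h := length_legs_le x₁ x₂ x₁ (List.finRange P.d) fun ν => Or.inl rfl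
    rw [List.length_finRange] at h
    exact_mod_cast h

/-- An isometry moves nothing far: `‖U(A(Γ))v − w‖ ≤ ‖v‖ + ‖w‖`. [cite: Balaban1982Higgs1, (1.7) p.605] -/
theorem norm_hol_sub_le (C : ChargeData N) (A : HiggsLattice.VecField P 0) (x : HiggsLattice.Site P 0)
    (Γ : List (HiggsLattice.Site P 0)) (v w : EuclideanSpace ℝ (Fin N)) : ‖hol C A x Γ v - w‖ ≤ ‖v‖ + ‖w‖ := by
  refine (norm_sub_le _ _).trans ?_
  rw [norm_hol_apply]

/-- **Coordinate expansion of the transported difference**: for a linear `f` and `φ = Σ_s φ_s e_s`,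
`U(A(Γ))(D^ε_A(fφ))(⟨x₂,μ⟩) − (D^ε_A(fφ))(⟨x₁,μ⟩) = Σ_s φ_s·[U(A(Γ))(D^ε_A(fe_s))(⟨x₂,μ⟩) − (D^ε_A(fe_s))(⟨x₁,μ⟩)]` (`U(A(Γ))` and `D^ε_A`
are linear). [cite: Balaban1982Higgs1, (1.5) p.604, (1.7) p.605] -/
theorem hol_covDeriv_sub_eq_sum_coord {i : ℕ} (C : ChargeData N) (A : HiggsLattice.VecField P 0)
    (f : ScalarField P i N →ₗ[ℝ] ScalarField P 0 N) (φ : ScalarField P i N) (x₁ x₂ : HiggsLattice.Site P 0)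
    (Γ : List (HiggsLattice.Site P 0)) (μ : Fin P.d) :
    hol C A x₁ Γ (covDeriv C A (f φ) ⟨x₂, μ⟩) - covDeriv C A (f φ) ⟨x₁, μ⟩
      = ∑ s : HiggsLattice.Site P i × Ix N, fieldCoord (E N) (HiggsLattice.Site P i) φ s •
          (hol C A x₁ Γ (covDeriv C A (f (cb P N i s)) ⟨x₂, μ⟩) - covDeriv C A (f (cb P N i s)) ⟨x₁, μ⟩) := by
  have h : f φ = ∑ s : HiggsLattice.Site P i × Ix N, fieldCoord (E N) (HiggsLattice.Site P i) φ s • f (cb P N i s) := by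
    conv_lhs => rw [← (cb P N i).sum_repr φ]
    rw [map_sum]
    refine Finset.sum_congr rfl fun s _ => ?_
    rw [map_smul, cb_repr]
  rw [h, covDeriv_sum'', covDeriv_sum'', map_sum, ← Finset.sum_sub_distrib]
  refine Finset.sum_congr rfl fun s _ => ?_
  rw [covDeriv_smul'', covDeriv_smul'', map_smul, smul_sub]

/-- Hence `‖U(A(Γ))(D^ε_A(fφ))(⟨x₂,μ⟩) − (D^ε_A(fφ))(⟨x₁,μ⟩)‖ ≤ Σ_s |φ_s|·‖U(A(Γ))(D^ε_A(fe_s))(⟨x₂,μ⟩) − (D^ε_A(fe_s))(⟨x₁,μ⟩)‖`.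
[cite: Balaban1982Higgs1, (1.5) p.604, (1.7) p.605] -/
theorem norm_hol_covDeriv_sub_le_sum_coord {i : ℕ} (C : ChargeData N) (A : HiggsLattice.VecField P 0)
    (f : ScalarField P i N →ₗ[ℝ] ScalarField P 0 N) (φ : ScalarField P i N) (x₁ x₂ : HiggsLattice.Site P 0)
    (Γ : List (HiggsLattice.Site P 0)) (μ : Fin P.d) :
    ‖hol C A x₁ Γ (covDeriv C A (f φ) ⟨x₂, μ⟩) - covDeriv C A (f φ) ⟨x₁, μ⟩‖
      ≤ ∑ s : HiggsLattice.Site P i × Ix N, |fieldCoord (E N) (HiggsLattice.Site P i) φ s| *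
          ‖hol C A x₁ Γ (covDeriv C A (f (cb P N i s)) ⟨x₂, μ⟩) - covDeriv C A (f (cb P N i s)) ⟨x₁, μ⟩‖ := by
  rw [hol_covDeriv_sub_eq_sum_coord]
  refine (norm_sum_le _ _).trans (Finset.sum_le_sum fun s _ => ?_)
  rw [norm_smul, Real.norm_eq_abs]

/-- Rate weakening in a decay factor. [folklore] -/
private theorem exp_rate_mono {ρ ρ' s : ℝ} (h : ρ' ≤ ρ) (hs : 0 ≤ s) : Real.exp (-(ρ * s)) ≤ Real.exp (-(ρ' * s)) :=
  Real.exp_le_exp.mpr (by nlinarith)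

/-- Monotonicity of a decay factor in the distance. [folklore] -/
private theorem exp_dist_mono {ρ s s' : ℝ} (hρ : 0 ≤ ρ) (h : s' ≤ s) : Real.exp (-(ρ * s)) ≤ Real.exp (-(ρ * s')) :=
  Real.exp_le_exp.mpr (by nlinarith)

/-- `e^{−ρa} + e^{−ρb} ≤ 2e^{−ρ·min(a,b)}` for `ρ ≥ 0`. [folklore] -/
private theorem add_exp_le_two_exp_min {ρ : ℝ} (hρ : 0 ≤ ρ) (a b : ℝ) :
    Real.exp (-(ρ * a)) + Real.exp (-(ρ * b)) ≤ 2 * Real.exp (-(ρ * min a b)) := by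
  have ha := exp_dist_mono hρ (min_le_left a b)
  have hb := exp_dist_mono hρ (min_le_right a b)
  linarith

/-- The decay factor at the block distance: `e^{−δD/L^l} ≤ e^{δ}e^{−δt}` for `D = max(0, L^l·t − (L^l − 1))` (p339501's private step,
re-derived). [folklore] -/
private theorem exp_blockDist_le {l : ℕ} (t : ℝ) {δ : ℝ} (hδ : 0 ≤ δ) :
    Real.exp (-(δ * (max 0 ((P.L : ℝ) ^ l * t - ((P.L : ℝ) ^ l - 1)) / (P.L : ℝ) ^ l)))
      ≤ Real.exp δ * Real.exp (-(δ * t)) := by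
  rw [← Real.exp_add]
  apply Real.exp_le_exp.mpr
  have hT : (0 : ℝ) < (P.L : ℝ) ^ l := pow_pos (by exact_mod_cast P.hL) l
  have h2 : t - 1 ≤ max 0 ((P.L : ℝ) ^ l * t - ((P.L : ℝ) ^ l - 1)) / (P.L : ℝ) ^ l := by
    rw [le_div_iff₀ hT]
    have h1 : (P.L : ℝ) ^ l * t - ((P.L : ℝ) ^ l - 1) ≤ max 0 ((P.L : ℝ) ^ l * t - ((P.L : ℝ) ^ l - 1)) :=
      le_max_right _ _
    nlinarith
  nlinarith [mul_le_mul_of_nonneg_left h2 hδ]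

end Algebra

/-! ## §1 The Hölder engine: the transported difference of one sandwich `G^ε_lQ_l^*C^{(l)}Q_lG^ε_l` from the located inputs

At one level `1 ≤ l ≤ K` the inputs are taken as hypotheses in the shape the tree's theorems print them: `hH` = the (I.2.24)
Hölder clause with its decay factor for `G^ε_l(T_ε, A)` at a fixed exponent `α` (p35's `norm_holder_propagatorK_reg_decay`, weight
`(|x₁ − x₂|/L^l)^{−α}` on the left, decay from the pair `{x₁, x₂}`), `hG` = the (I.2.25) value clause (third kernel, by adjointness),
`hC` = the (I.2.34) kernel bound of `C^{(l)}(T_ε, A)`. -/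

section Engine

variable (C : ChargeData N) (A : HiggsLattice.VecField P 0) (msq a : ℝ) {l : ℕ} {α : ℝ}

/-- **First kernel, Hölder-transported** — for an admissible contour `Γ` from `x₁` to `x₂ ≠ x₁`:
`(|x₁−x₂|/L^l)^{−α}‖U(A(Γ))(D^ε_AG^ε_lQ_l^*e_s)(⟨x₂,μ⟩) − (D^ε_AG^ε_lQ_l^*e_s)(⟨x₁,μ⟩)‖ ≤ c_H·e^{δ}·(e^{−δ|x₁,ₗ − y_s|} + e^{−δ|x₂,ₗ − y_s|})·√N`
from the (I.2.24) Hölder clause at level `l` (source `Q_l^*e_s`: sup `≤ √N`, support `B^l(y_s)`, at block distance from BOTH points).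
[cite: Balaban1982Higgs1, Prop. 2.1 (2.24) p.610] [cite: Balaban1983Higgs3, (2.11) p.426] -/
theorem holder_G_avgQkAdj_cb_le (hl : l ≤ P.K) {cH δ : ℝ} (hcH : 0 ≤ cH) (hδ : 0 ≤ δ)
    (hH : ∀ (g : ScalarField P 0 N) (M D : ℝ), (∀ x, ‖g x‖ ≤ M) → 0 ≤ D →
      ∀ (μ : Fin P.d) (x x' : HiggsLattice.Site P 0), x' ≠ x → ∀ Γ : List (HiggsLattice.Site P 0), IsTChain x Γ →
        pathEnd x Γ = x' → (Γ.length : ℝ) ≤ (P.d : ℝ) * HiggsLattice.Site.tdist x x' →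
        (∀ z, g z ≠ 0 → D ≤ (HiggsLattice.Site.tdist x z : ℝ)) → (∀ z, g z ≠ 0 → D ≤ (HiggsLattice.Site.tdist x' z : ℝ)) →
          (((HiggsLattice.Site.tdist x x' : ℝ) / (P.L : ℝ) ^ l)⁻¹) ^ α *
              ‖hol C A x Γ (covDeriv C A (propagatorK C Finset.univ A msq a l g) ⟨x', μ⟩)
                - covDeriv C A (propagatorK C Finset.univ A msq a l g) ⟨x, μ⟩‖
            ≤ cH * Real.exp (-(δ * (D / (P.L : ℝ) ^ l))) * M)
    (s : HiggsLattice.Site P l × Ix N) (μ : Fin P.d) {x₁ x₂ : HiggsLattice.Site P 0} (hne : x₂ ≠ x₁)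
    {Γ : List (HiggsLattice.Site P 0)} (hΓ : IsAdm x₁ x₂ Γ) :
    (((HiggsLattice.Site.tdist x₁ x₂ : ℝ) / (P.L : ℝ) ^ l)⁻¹) ^ α *
        ‖hol C A x₁ Γ (covDeriv C A (propagatorK C Finset.univ A msq a l (avgQkAdj C A l (cb P N l s))) ⟨x₂, μ⟩)
          - covDeriv C A (propagatorK C Finset.univ A msq a l (avgQkAdj C A l (cb P N l s))) ⟨x₁, μ⟩‖
      ≤ cH * Real.exp δ * (Real.exp (-(δ * (HiggsLattice.Site.tdist (blockIter l x₁) s.1 : ℝ))) +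
          Real.exp (-(δ * (HiggsLattice.Site.tdist (blockIter l x₂) s.1 : ℝ)))) * Real.sqrt N := by
  set D₁ : ℝ := max 0 ((P.L : ℝ) ^ l * (HiggsLattice.Site.tdist (blockIter l x₁) s.1 : ℝ) - ((P.L : ℝ) ^ l - 1)) with hD₁
  set D₂ : ℝ := max 0 ((P.L : ℝ) ^ l * (HiggsLattice.Site.tdist (blockIter l x₂) s.1 : ℝ) - ((P.L : ℝ) ^ l - 1)) with hD₂
  have h := hH (avgQkAdj C A l (cb P N l s)) (Real.sqrt N) (min D₁ D₂) (norm_avgQkAdj_cb_le C A s)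
    (le_min (le_max_left _ _) (le_max_left _ _)) μ x₁ x₂ hne Γ hΓ.1 hΓ.2.1 hΓ.2.2
    (fun z hz => (min_le_left _ _).trans (blockDist_le_tdist hl x₁ s.1 (blockIter_eq_of_avgQkAdj_cb_ne_zero C A s hz)))
    (fun z hz => (min_le_right _ _).trans (blockDist_le_tdist hl x₂ s.1 (blockIter_eq_of_avgQkAdj_cb_ne_zero C A s hz)))
  refine h.trans ?_
  have hs : 0 ≤ Real.sqrt (N : ℝ) := Real.sqrt_nonneg _
  have he : Real.exp (-(δ * (min D₁ D₂ / (P.L : ℝ) ^ l)))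
      ≤ Real.exp δ * (Real.exp (-(δ * (HiggsLattice.Site.tdist (blockIter l x₁) s.1 : ℝ))) +
          Real.exp (-(δ * (HiggsLattice.Site.tdist (blockIter l x₂) s.1 : ℝ)))) := by
    have h1 := exp_blockDist_le (P := P) (l := l) (HiggsLattice.Site.tdist (blockIter l x₁) s.1 : ℝ) hδ
    have h2 := exp_blockDist_le (P := P) (l := l) (HiggsLattice.Site.tdist (blockIter l x₂) s.1 : ℝ) hδ
    rw [← hD₁] at h1
    rw [← hD₂] at h2
    have e1 : 0 ≤ Real.exp δ * Real.exp (-(δ * (HiggsLattice.Site.tdist (blockIter l x₁) s.1 : ℝ))) := by positivity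
    have e2 : 0 ≤ Real.exp δ * Real.exp (-(δ * (HiggsLattice.Site.tdist (blockIter l x₂) s.1 : ℝ))) := by positivity
    rcases min_choice D₁ D₂ with hm | hm <;> rw [hm] <;> linarith
  calc cH * Real.exp (-(δ * (min D₁ D₂ / (P.L : ℝ) ^ l))) * Real.sqrt N
      ≤ cH * (Real.exp δ * (Real.exp (-(δ * (HiggsLattice.Site.tdist (blockIter l x₁) s.1 : ℝ))) +
          Real.exp (-(δ * (HiggsLattice.Site.tdist (blockIter l x₂) s.1 : ℝ))))) * Real.sqrt N :=
        mul_le_mul_of_nonneg_right (mul_le_mul_of_nonneg_left he hcH) hs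
    _ = _ := by ring

/-- **THE SANDWICH, HÖLDER-TRANSPORTED** — from the three inputs at level `l ≤ K` with a common rate `δ > 0`, for an admissible
contour `Γ` from `x₁` to `x₂ ≠ x₁`:
`(|x₁−x₂|/L^l)^{−α}‖U(A(Γ))(D^ε_A G^ε_lQ_l^*C^{(l)}Q_lG^ε_l e_q)(⟨x₂,μ⟩) − (D^ε_A G^ε_lQ_l^*C^{(l)}Q_lG^ε_l e_q)(⟨x₁,μ⟩)‖
 ≤ (c_He^{δ}√N)(c_Ge^{δ}√N)·c_C·L^{−ld}·(2K(δ/2)²e^{δ/2})·e^{−(δ/2)min(|x₁ − x_q|, |x₂ − x_q|)/L^l}` (coordinate expansion, the three kernels,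
the three-kernel convolution from `x₁` and from `x₂`, block labels back to the fine distance).
[cite: Balaban1982Higgs1, (2.43) p.612, Prop. 2.1 (2.24)–(2.25) p.610, Prop. 2.3 (2.34) p.611] [cite: Balaban1983Higgs3, (2.11) p.426] -/
theorem holder_sandwich_cb_le (hl : l ≤ P.K) {cG cH cC δ : ℝ} (hcG : 0 ≤ cG) (hcH : 0 ≤ cH) (hcC : 0 ≤ cC) (hδ : 0 < δ)
    (hG : ∀ (g : ScalarField P 0 N) (M D : ℝ), (∀ x, ‖g x‖ ≤ M) → 0 ≤ D →
      ∀ x, (∀ z, g z ≠ 0 → D ≤ (HiggsLattice.Site.tdist x z : ℝ)) →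
        ‖propagatorK C Finset.univ A msq a l g x‖ ≤ cG * Real.exp (-(δ * (D / (P.L : ℝ) ^ l))) * M)
    (hH : ∀ (g : ScalarField P 0 N) (M D : ℝ), (∀ x, ‖g x‖ ≤ M) → 0 ≤ D →
      ∀ (μ : Fin P.d) (x x' : HiggsLattice.Site P 0), x' ≠ x → ∀ Γ : List (HiggsLattice.Site P 0), IsTChain x Γ →
        pathEnd x Γ = x' → (Γ.length : ℝ) ≤ (P.d : ℝ) * HiggsLattice.Site.tdist x x' →
        (∀ z, g z ≠ 0 → D ≤ (HiggsLattice.Site.tdist x z : ℝ)) → (∀ z, g z ≠ 0 → D ≤ (HiggsLattice.Site.tdist x' z : ℝ)) →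
          (((HiggsLattice.Site.tdist x x' : ℝ) / (P.L : ℝ) ^ l)⁻¹) ^ α *
              ‖hol C A x Γ (covDeriv C A (propagatorK C Finset.univ A msq a l g) ⟨x', μ⟩)
                - covDeriv C A (propagatorK C Finset.univ A msq a l g) ⟨x, μ⟩‖
            ≤ cH * Real.exp (-(δ * (D / (P.L : ℝ) ^ l))) * M)
    (hC : ∀ s t : HiggsLattice.Site P l × Ix N,
      |mat (fluctCovA C Finset.univ A msq a l) s t| ≤ cC * Real.exp (-(δ * (HiggsLattice.Site.tdist s.1 t.1 : ℝ))))
    (q : HiggsLattice.Site P 0 × Ix N) (μ : Fin P.d) {x₁ x₂ : HiggsLattice.Site P 0} (hne : x₂ ≠ x₁)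
    {Γ : List (HiggsLattice.Site P 0)} (hΓ : IsAdm x₁ x₂ Γ) :
    (((HiggsLattice.Site.tdist x₁ x₂ : ℝ) / (P.L : ℝ) ^ l)⁻¹) ^ α *
        ‖hol C A x₁ Γ (covDeriv C A (sandwich C A msq a l (cb P N 0 q)) ⟨x₂, μ⟩)
          - covDeriv C A (sandwich C A msq a l (cb P N 0 q)) ⟨x₁, μ⟩‖
      ≤ (cH * Real.exp δ * Real.sqrt N) * (cG * Real.exp δ * Real.sqrt N) * cC * (((P.L : ℝ) ^ l) ^ P.d)⁻¹ *
          (2 * profile P N (δ / 2) ^ 2 * Real.exp (δ / 2)) *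
          Real.exp (-(δ / 2 * (min (HiggsLattice.Site.tdist x₁ q.1 : ℝ) (HiggsLattice.Site.tdist x₂ q.1 : ℝ) / (P.L : ℝ) ^ l))) := by
  set W : ℝ := (((HiggsLattice.Site.tdist x₁ x₂ : ℝ) / (P.L : ℝ) ^ l)⁻¹) ^ α with hW
  have hW0 : 0 ≤ W := Real.rpow_nonneg (inv_nonneg.mpr (by positivity)) _
  have h0 : sandwich C A msq a l (cb P N 0 q) = (propagatorK C Finset.univ A msq a l ∘ₗ avgQkAdj C A l)
      (fluctCovA C Finset.univ A msq a l (avgQkLin C A l (propagatorK C Finset.univ A msq a l (cb P N 0 q)))) := by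
    simp only [sandwich, LinearMap.comp_apply]
  rw [h0]
  have hK : 0 ≤ profile P N (δ / 2) := profile_nonneg' _ (by linarith)
  -- coordinate expansion, the weight distributed over the sum
  refine (mul_le_mul_of_nonneg_left (norm_hol_covDeriv_sub_le_sum_coord C A _ _ x₁ x₂ Γ μ) hW0).trans ?_
  rw [Finset.mul_sum]
  calc ∑ s : HiggsLattice.Site P l × Ix N, W * (|fieldCoord (E N) (HiggsLattice.Site P l)
            (fluctCovA C Finset.univ A msq a l (avgQkLin C A l (propagatorK C Finset.univ A msq a l (cb P N 0 q)))) s| *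
          ‖hol C A x₁ Γ (covDeriv C A ((propagatorK C Finset.univ A msq a l ∘ₗ avgQkAdj C A l) (cb P N l s)) ⟨x₂, μ⟩)
            - covDeriv C A ((propagatorK C Finset.univ A msq a l ∘ₗ avgQkAdj C A l) (cb P N l s)) ⟨x₁, μ⟩‖)
      ≤ ∑ s : HiggsLattice.Site P l × Ix N,
          (∑ t : HiggsLattice.Site P l × Ix N, cC * Real.exp (-(δ * (HiggsLattice.Site.tdist s.1 t.1 : ℝ))) *
            ((((P.L : ℝ) ^ l) ^ P.d)⁻¹ *
              (cG * Real.exp δ * Real.exp (-(δ * (HiggsLattice.Site.tdist (blockIter l q.1) t.1 : ℝ))) * Real.sqrt N))) *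
          (cH * Real.exp δ * (Real.exp (-(δ * (HiggsLattice.Site.tdist (blockIter l x₁) s.1 : ℝ))) +
            Real.exp (-(δ * (HiggsLattice.Site.tdist (blockIter l x₂) s.1 : ℝ)))) * Real.sqrt N) := by
        refine Finset.sum_le_sum fun s _ => ?_
        have h1 : |fieldCoord (E N) (HiggsLattice.Site P l)
              (fluctCovA C Finset.univ A msq a l (avgQkLin C A l (propagatorK C Finset.univ A msq a l (cb P N 0 q)))) s|
            ≤ ∑ t : HiggsLattice.Site P l × Ix N, cC * Real.exp (-(δ * (HiggsLattice.Site.tdist s.1 t.1 : ℝ))) *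
              ((((P.L : ℝ) ^ l) ^ P.d)⁻¹ *
                (cG * Real.exp δ * Real.exp (-(δ * (HiggsLattice.Site.tdist (blockIter l q.1) t.1 : ℝ))) * Real.sqrt N)) :=
          (abs_coord_CQG_le C A msq a s q).trans (Finset.sum_le_sum fun t _ =>
            mul_le_mul (hC s t) (abs_mat_QG_le C A msq a hl hcG hδ.le hG t q) (abs_nonneg _) (by positivity))
        have h2 : W * ‖hol C A x₁ Γ (covDeriv C A ((propagatorK C Finset.univ A msq a l ∘ₗ avgQkAdj C A l) (cb P N l s)) ⟨x₂, μ⟩)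
              - covDeriv C A ((propagatorK C Finset.univ A msq a l ∘ₗ avgQkAdj C A l) (cb P N l s)) ⟨x₁, μ⟩‖
            ≤ cH * Real.exp δ * (Real.exp (-(δ * (HiggsLattice.Site.tdist (blockIter l x₁) s.1 : ℝ))) +
                Real.exp (-(δ * (HiggsLattice.Site.tdist (blockIter l x₂) s.1 : ℝ)))) * Real.sqrt N := by
          rw [LinearMap.comp_apply]
          exact holder_G_avgQkAdj_cb_le C A msq a hl hcH hδ.le hH s μ hne hΓ
        calc W * (|fieldCoord (E N) (HiggsLattice.Site P l)
                (fluctCovA C Finset.univ A msq a l (avgQkLin C A l (propagatorK C Finset.univ A msq a l (cb P N 0 q)))) s| *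
              ‖hol C A x₁ Γ (covDeriv C A ((propagatorK C Finset.univ A msq a l ∘ₗ avgQkAdj C A l) (cb P N l s)) ⟨x₂, μ⟩)
                - covDeriv C A ((propagatorK C Finset.univ A msq a l ∘ₗ avgQkAdj C A l) (cb P N l s)) ⟨x₁, μ⟩‖)
            = |fieldCoord (E N) (HiggsLattice.Site P l)
                (fluctCovA C Finset.univ A msq a l (avgQkLin C A l (propagatorK C Finset.univ A msq a l (cb P N 0 q)))) s| *
              (W * ‖hol C A x₁ Γ (covDeriv C A ((propagatorK C Finset.univ A msq a l ∘ₗ avgQkAdj C A l) (cb P N l s)) ⟨x₂, μ⟩)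
                - covDeriv C A ((propagatorK C Finset.univ A msq a l ∘ₗ avgQkAdj C A l) (cb P N l s)) ⟨x₁, μ⟩‖) := by ring
          _ ≤ _ := mul_le_mul h1 h2 (mul_nonneg hW0 (norm_nonneg _)) (Finset.sum_nonneg fun t _ => by positivity)
    _ = (cH * Real.exp δ * Real.sqrt N) * (cG * Real.exp δ * Real.sqrt N) * cC * (((P.L : ℝ) ^ l) ^ P.d)⁻¹ *
          ((∑ s : HiggsLattice.Site P l × Ix N, ∑ t : HiggsLattice.Site P l × Ix N,
            Real.exp (-(δ * (HiggsLattice.Site.tdist (blockIter l x₁) s.1 : ℝ))) *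
              Real.exp (-(δ * (HiggsLattice.Site.tdist s.1 t.1 : ℝ))) *
              Real.exp (-(δ * (HiggsLattice.Site.tdist (blockIter l q.1) t.1 : ℝ)))) +
          (∑ s : HiggsLattice.Site P l × Ix N, ∑ t : HiggsLattice.Site P l × Ix N,
            Real.exp (-(δ * (HiggsLattice.Site.tdist (blockIter l x₂) s.1 : ℝ))) *
              Real.exp (-(δ * (HiggsLattice.Site.tdist s.1 t.1 : ℝ))) *
              Real.exp (-(δ * (HiggsLattice.Site.tdist (blockIter l q.1) t.1 : ℝ))))) := by
        rw [← Finset.sum_add_distrib, Finset.mul_sum]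
        refine Finset.sum_congr rfl fun s _ => ?_
        rw [← Finset.sum_add_distrib, Finset.sum_mul, Finset.mul_sum]
        refine Finset.sum_congr rfl fun t _ => ?_
        ring
    _ ≤ (cH * Real.exp δ * Real.sqrt N) * (cG * Real.exp δ * Real.sqrt N) * cC * (((P.L : ℝ) ^ l) ^ P.d)⁻¹ *
          (profile P N (δ / 2) ^ 2 * Real.exp (-(δ / 2 * (HiggsLattice.Site.tdist (blockIter l x₁) (blockIter l q.1) : ℝ))) +
            profile P N (δ / 2) ^ 2 * Real.exp (-(δ / 2 * (HiggsLattice.Site.tdist (blockIter l x₂) (blockIter l q.1) : ℝ)))) :=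
        mul_le_mul_of_nonneg_left (add_le_add (sum3_le hδ (blockIter l x₁) (blockIter l q.1) q.2)
          (sum3_le hδ (blockIter l x₂) (blockIter l q.1) q.2)) (by positivity)
    _ ≤ (cH * Real.exp δ * Real.sqrt N) * (cG * Real.exp δ * Real.sqrt N) * cC * (((P.L : ℝ) ^ l) ^ P.d)⁻¹ *
          (profile P N (δ / 2) ^ 2 * (Real.exp (δ / 2) *
            Real.exp (-(δ / 2 * ((HiggsLattice.Site.tdist x₁ q.1 : ℝ) / (P.L : ℝ) ^ l)))) +
          profile P N (δ / 2) ^ 2 * (Real.exp (δ / 2) *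
            Real.exp (-(δ / 2 * ((HiggsLattice.Site.tdist x₂ q.1 : ℝ) / (P.L : ℝ) ^ l))))) :=
        mul_le_mul_of_nonneg_left (add_le_add
          (mul_le_mul_of_nonneg_left (exp_blockIter_le hl hδ.le x₁ q.1) (pow_nonneg hK 2))
          (mul_le_mul_of_nonneg_left (exp_blockIter_le hl hδ.le x₂ q.1) (pow_nonneg hK 2))) (by positivity)
    _ = (cH * Real.exp δ * Real.sqrt N) * (cG * Real.exp δ * Real.sqrt N) * cC * (((P.L : ℝ) ^ l) ^ P.d)⁻¹ *
          (profile P N (δ / 2) ^ 2 * Real.exp (δ / 2)) *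
          (Real.exp (-(δ / 2 * ((HiggsLattice.Site.tdist x₁ q.1 : ℝ) / (P.L : ℝ) ^ l))) +
            Real.exp (-(δ / 2 * ((HiggsLattice.Site.tdist x₂ q.1 : ℝ) / (P.L : ℝ) ^ l)))) := by ring
    _ ≤ (cH * Real.exp δ * Real.sqrt N) * (cG * Real.exp δ * Real.sqrt N) * cC * (((P.L : ℝ) ^ l) ^ P.d)⁻¹ *
          (profile P N (δ / 2) ^ 2 * Real.exp (δ / 2)) *
          (2 * Real.exp (-(δ / 2 * (min (HiggsLattice.Site.tdist x₁ q.1 : ℝ) (HiggsLattice.Site.tdist x₂ q.1 : ℝ) /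
            (P.L : ℝ) ^ l)))) := by
        refine mul_le_mul_of_nonneg_left ?_ (by positivity)
        have hT : (0 : ℝ) < (P.L : ℝ) ^ l := pow_pos (by exact_mod_cast P.hL) l
        rw [← min_div_div_right hT.le]
        exact add_exp_le_two_exp_min (by linarith) _ _
    _ = _ := by ring

end Engine

/-! ## §2 The pieces: `(|x₁−x₂|/L^j)^{−α}·ε^{−d}Σ_{i′}‖U(A(Γ))(D^ε_{A,μ}G^η_{(j)}e_{(x,i′)})(x₂) − (D^ε_{A,μ}G^η_{(j)}e_{(x,i′)})(x₁)‖`, piece by piece -/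

section PieceBounds

variable (C : ChargeData N) (A : HiggsLattice.VecField P 0) (msq : ℝ) {a : ℝ} {k j : ℕ} {α : ℝ}

/-- The transported Hölder term of the piece `j` along the contour `Γ` (the summand of `holderDiff` before the supremum):
`ε^{−d}Σ_{i′}‖U(A(Γ))(D^ε_{A,μ}G^η_{(j)}e_{(x,i′)})(⟨x₂,μ⟩) − (D^ε_{A,μ}G^η_{(j)}e_{(x,i′)})(⟨x₁,μ⟩)‖`. [cite: Balaban1983Higgs3, (2.11) p.426] -/
def holderTerm (a : ℝ) (k j : ℕ) (μ : Fin P.d) (x₁ x₂ x : HiggsLattice.Site P 0) (Γ : List (HiggsLattice.Site P 0)) : ℝ :=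
  (P.mesh 0 ^ P.d)⁻¹ * ∑ i' : Ix N,
    ‖hol C A x₁ Γ (covDeriv C A (pieceA C A msq a k j (cb P N 0 (x, i'))) ⟨x₂, μ⟩)
      - covDeriv C A (pieceA C A msq a k j (cb P N 0 (x, i'))) ⟨x₁, μ⟩‖

/-- `holderTerm ≥ 0`. [cite: Balaban1983Higgs3, (2.11) p.426] -/
theorem holderTerm_nonneg (μ : Fin P.d) (x₁ x₂ x : HiggsLattice.Site P 0) (Γ : List (HiggsLattice.Site P 0)) :
    0 ≤ holderTerm C A msq a k j μ x₁ x₂ x Γ :=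
  mul_nonneg (inv_nonneg.mpr (pow_nonneg (P.mesh_pos 0).le _)) (Finset.sum_nonneg fun _ _ => norm_nonneg _)

/-- A contour-independent bound (the transports are isometries): `holderTerm ≤ ε^{−d}Σ_{i′}(‖(D G e)(x₂)‖ + ‖(D G e)(x₁)‖)`.
[cite: Balaban1982Higgs1, (1.7) p.605] -/
theorem holderTerm_le_unif (μ : Fin P.d) (x₁ x₂ x : HiggsLattice.Site P 0) (Γ : List (HiggsLattice.Site P 0)) :
    holderTerm C A msq a k j μ x₁ x₂ x Γ ≤ (P.mesh 0 ^ P.d)⁻¹ * ∑ i' : Ix N,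
      (‖covDeriv C A (pieceA C A msq a k j (cb P N 0 (x, i'))) ⟨x₂, μ⟩‖
        + ‖covDeriv C A (pieceA C A msq a k j (cb P N 0 (x, i'))) ⟨x₁, μ⟩‖) := by
  unfold holderTerm
  exact mul_le_mul_of_nonneg_left (Finset.sum_le_sum fun i' _ => norm_hol_sub_le C A x₁ Γ _ _)
    (inv_nonneg.mpr (pow_nonneg (P.mesh_pos 0).le _))

/-- scaling bookkeeping: `ε^{−d}·L^{−jd} = (L^jε)^{−d}`. [cite: Balaban1982Higgs1, (1.19) p.607] -/
private theorem inv_mesh_zero_pow_mul (j : ℕ) :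
    (P.mesh 0 ^ P.d)⁻¹ * (((P.L : ℝ) ^ j) ^ P.d)⁻¹ = (P.mesh j ^ P.d)⁻¹ := by
  rw [mesh_eq_pow_mul P j, mul_pow, mul_inv, mul_comm]

/-- scaling bookkeeping: `(L^jε)^{−n}(L^jε)^{n+m} = (L^jε)^m`. [cite: Balaban1982Higgs1, (1.19) p.607] -/
private theorem mesh_pow_cancel (j n m : ℕ) : (P.mesh j ^ n)⁻¹ * P.mesh j ^ (n + m) = P.mesh j ^ m := by
  rw [pow_add, inv_mul_cancel_left₀ (pow_ne_zero _ (P.mesh_pos j).ne')]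

/-- **Piece `j = 0`**: `(|x₁−x₂|/L^0)^{−α}·ε^{−d}Σ_{i′}‖U(A(Γ))(D^ε_AG^ε_1e_{(x,i′)})(⟨x₂,μ⟩) − (D^ε_AG^ε_1e_{(x,i′)})(⟨x₁,μ⟩)‖ ≤
N√N·c_H·L·ε·ε^{−d}·e^{−ρ·min(|x₁−x|,|x₂−x|)/L}` from the (I.2.24) Hölder clause at level `1` (`G^η_{(0)} = G^ε_1`; source
`e_{(x,i′)}`: sup `≤ √N`, support `{x}`; the weight at level `1` dominates the weight at level `0` since `α ≥ 0`, `L ≥ 1`).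
[cite: Balaban1983Higgs3, (2.6) p.424, (2.11) p.426] [cite: Balaban1982Higgs1, Prop. 2.1 (2.24) p.610] -/
theorem holder_piece_zero_le (hα : 0 ≤ α) {cH ρ : ℝ}
    (hH : ∀ (g : ScalarField P 0 N) (M D : ℝ), (∀ x, ‖g x‖ ≤ M) → 0 ≤ D →
      ∀ (μ : Fin P.d) (x x' : HiggsLattice.Site P 0), x' ≠ x → ∀ Γ : List (HiggsLattice.Site P 0), IsTChain x Γ →
        pathEnd x Γ = x' → (Γ.length : ℝ) ≤ (P.d : ℝ) * HiggsLattice.Site.tdist x x' →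
        (∀ z, g z ≠ 0 → D ≤ (HiggsLattice.Site.tdist x z : ℝ)) → (∀ z, g z ≠ 0 → D ≤ (HiggsLattice.Site.tdist x' z : ℝ)) →
          (((HiggsLattice.Site.tdist x x' : ℝ) / (P.L : ℝ) ^ 1)⁻¹) ^ α *
              ‖hol C A x Γ (covDeriv C A (propagatorK C Finset.univ A msq a 1 g) ⟨x', μ⟩)
                - covDeriv C A (propagatorK C Finset.univ A msq a 1 g) ⟨x, μ⟩‖
            ≤ cH * P.mesh 1 * Real.exp (-(ρ * (D / (P.L : ℝ) ^ 1))) * M)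
    (μ : Fin P.d) {x₁ x₂ : HiggsLattice.Site P 0} (hne : x₂ ≠ x₁) (x : HiggsLattice.Site P 0)
    {Γ : List (HiggsLattice.Site P 0)} (hΓ : IsAdm x₁ x₂ Γ) :
    (((HiggsLattice.Site.tdist x₁ x₂ : ℝ) / (P.L : ℝ) ^ 0)⁻¹) ^ α * holderTerm C A msq a k 0 μ x₁ x₂ x Γ
      ≤ ((N : ℝ) * Real.sqrt N * cH * (P.L : ℝ)) * (P.mesh 0 * (P.mesh 0 ^ P.d)⁻¹) *
          Real.exp (-(ρ * (min (HiggsLattice.Site.tdist x₁ x : ℝ) (HiggsLattice.Site.tdist x₂ x : ℝ) / (P.L : ℝ) ^ 1))) := by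
  set W₀ : ℝ := (((HiggsLattice.Site.tdist x₁ x₂ : ℝ) / (P.L : ℝ) ^ 0)⁻¹) ^ α with hW₀
  set W₁ : ℝ := (((HiggsLattice.Site.tdist x₁ x₂ : ℝ) / (P.L : ℝ) ^ 1)⁻¹) ^ α with hW₁
  set X := Real.exp (-(ρ * (min (HiggsLattice.Site.tdist x₁ x : ℝ) (HiggsLattice.Site.tdist x₂ x : ℝ) / (P.L : ℝ) ^ 1))) with hX
  have hL1 : (1 : ℝ) ≤ P.L := by exact_mod_cast P.hL
  have ht0 : (0 : ℝ) ≤ (HiggsLattice.Site.tdist x₁ x₂ : ℝ) := Nat.cast_nonneg _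
  -- the two weights: `W₀ ≤ W₁` (`(1/t)^α ≤ (L/t)^α`)
  have hW₀1 : W₀ ≤ W₁ := by
    rw [hW₀, hW₁, pow_zero, div_one, pow_one, inv_div, div_eq_mul_inv]
    exact Real.rpow_le_rpow (inv_nonneg.mpr ht0) (le_mul_of_one_le_left (inv_nonneg.mpr ht0) hL1) hα
  have h1 : ∀ i' : Ix N, W₁ * ‖hol C A x₁ Γ (covDeriv C A (pieceA C A msq a k 0 (cb P N 0 (x, i'))) ⟨x₂, μ⟩)
        - covDeriv C A (pieceA C A msq a k 0 (cb P N 0 (x, i'))) ⟨x₁, μ⟩‖ ≤ cH * P.mesh 1 * X * Real.sqrt N := by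
    intro i'
    rw [pieceA_zero]
    exact hH (cb P N 0 (x, i')) (Real.sqrt N) (min (HiggsLattice.Site.tdist x₁ x : ℝ) (HiggsLattice.Site.tdist x₂ x : ℝ))
      (norm_cb_le _) (le_min (Nat.cast_nonneg _) (Nat.cast_nonneg _)) μ x₁ x₂ hne Γ hΓ.1 hΓ.2.1 hΓ.2.2
      (fun z hz => by rw [eq_of_cb_ne_zero _ hz]; exact min_le_left _ _)
      (fun z hz => by rw [eq_of_cb_ne_zero _ hz]; exact min_le_right _ _)
  have hsum : W₁ * ∑ i' : Ix N, ‖hol C A x₁ Γ (covDeriv C A (pieceA C A msq a k 0 (cb P N 0 (x, i'))) ⟨x₂, μ⟩)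
        - covDeriv C A (pieceA C A msq a k 0 (cb P N 0 (x, i'))) ⟨x₁, μ⟩‖ ≤ N * (cH * P.mesh 1 * X * Real.sqrt N) := by
    rw [Finset.mul_sum]
    refine (Finset.sum_le_sum fun i' _ => h1 i').trans ?_
    rw [Finset.sum_const, card_Ix, nsmul_eq_mul]
  have hm0 : 0 ≤ (P.mesh 0 ^ P.d)⁻¹ := inv_nonneg.mpr (pow_nonneg (P.mesh_pos 0).le _)
  calc W₀ * holderTerm C A msq a k 0 μ x₁ x₂ x Γ
      ≤ W₁ * holderTerm C A msq a k 0 μ x₁ x₂ x Γ := mul_le_mul_of_nonneg_right hW₀1 (holderTerm_nonneg C A msq μ x₁ x₂ x Γ)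
    _ = (P.mesh 0 ^ P.d)⁻¹ * (W₁ * ∑ i' : Ix N, ‖hol C A x₁ Γ (covDeriv C A (pieceA C A msq a k 0 (cb P N 0 (x, i'))) ⟨x₂, μ⟩)
        - covDeriv C A (pieceA C A msq a k 0 (cb P N 0 (x, i'))) ⟨x₁, μ⟩‖) := by unfold holderTerm; ring
    _ ≤ (P.mesh 0 ^ P.d)⁻¹ * (N * (cH * P.mesh 1 * X * Real.sqrt N)) := mul_le_mul_of_nonneg_left hsum hm0
    _ = _ := by rw [mesh_eq_pow_mul P 1, pow_one]; ring

/-- **Piece `1 ≤ j < k`**: `(|x₁−x₂|/L^j)^{−α}·ε^{−d}Σ_{i′}‖U(A(Γ))(D^ε_AG^η_{(j)}e_{(x,i′)})(⟨x₂,μ⟩) − (D^ε_AG^η_{(j)}e_{(x,i′)})(⟨x₁,μ⟩)‖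
≤ N²a²(c_Hc₀)c₁·e^{2δ}(2e^{δ/2})K(δ/2)² · (L^jε)(L^jε)^{−d} · e^{−(δ/2)min(|x₁−x|,|x₂−x|)/L^j}` — the scaling
`ε^{−d}·a_j²(L^jε)^{−4}·(L^jε)^{1+2+2}·L^{−jd} = a_j²(L^jε)^{1−d}` of the print's «rescaling from the η-lattice to the L^{−j}-lattice»
(the Hölder weight is already at level `j`). [cite: Balaban1983Higgs3, (2.6) p.424, (2.11) p.426] [cite: Balaban1982Higgs1, (2.43) p.612] -/
theorem holder_piece_pos_le (ha : 0 < a) (hL1 : 1 < P.L) (hj1 : 1 ≤ j) (hjk : j < k) (hjK : j ≤ P.K)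
    {c₀ cH c₁ δ : ℝ} (hc₀ : 0 ≤ c₀) (hcH : 0 ≤ cH) (hc₁ : 0 ≤ c₁) (hδ : 0 < δ)
    (hG : ∀ (g : ScalarField P 0 N) (M D : ℝ), (∀ x, ‖g x‖ ≤ M) → 0 ≤ D →
      ∀ x, (∀ z, g z ≠ 0 → D ≤ (HiggsLattice.Site.tdist x z : ℝ)) →
        ‖propagatorK C Finset.univ A msq a j g x‖ ≤ c₀ * P.mesh j ^ 2 * Real.exp (-(δ * (D / (P.L : ℝ) ^ j))) * M)
    (hH : ∀ (g : ScalarField P 0 N) (M D : ℝ), (∀ x, ‖g x‖ ≤ M) → 0 ≤ D →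
      ∀ (μ : Fin P.d) (x x' : HiggsLattice.Site P 0), x' ≠ x → ∀ Γ : List (HiggsLattice.Site P 0), IsTChain x Γ →
        pathEnd x Γ = x' → (Γ.length : ℝ) ≤ (P.d : ℝ) * HiggsLattice.Site.tdist x x' →
        (∀ z, g z ≠ 0 → D ≤ (HiggsLattice.Site.tdist x z : ℝ)) → (∀ z, g z ≠ 0 → D ≤ (HiggsLattice.Site.tdist x' z : ℝ)) →
          (((HiggsLattice.Site.tdist x x' : ℝ) / (P.L : ℝ) ^ j)⁻¹) ^ α *
              ‖hol C A x Γ (covDeriv C A (propagatorK C Finset.univ A msq a j g) ⟨x', μ⟩)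
                - covDeriv C A (propagatorK C Finset.univ A msq a j g) ⟨x, μ⟩‖
            ≤ cH * P.mesh j * Real.exp (-(δ * (D / (P.L : ℝ) ^ j))) * M)
    (hC : ∀ s t : HiggsLattice.Site P j × Ix N,
      |mat (fluctCovA C Finset.univ A msq a j) s t| ≤ c₁ * P.mesh j ^ 2 * Real.exp (-(δ * (HiggsLattice.Site.tdist s.1 t.1 : ℝ))))
    (μ : Fin P.d) {x₁ x₂ : HiggsLattice.Site P 0} (hne : x₂ ≠ x₁) (x : HiggsLattice.Site P 0)
    {Γ : List (HiggsLattice.Site P 0)} (hΓ : IsAdm x₁ x₂ Γ) :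
    (((HiggsLattice.Site.tdist x₁ x₂ : ℝ) / (P.L : ℝ) ^ j)⁻¹) ^ α * holderTerm C A msq a k j μ x₁ x₂ x Γ
      ≤ ((N : ℝ) ^ 2 * a ^ 2 * (cH * c₀) * c₁ * (Real.exp δ ^ 2 * (2 * Real.exp (δ / 2)) * profile P N (δ / 2) ^ 2)) *
        (P.mesh j * (P.mesh j ^ P.d)⁻¹) *
          Real.exp (-(δ / 2 * (min (HiggsLattice.Site.tdist x₁ x : ℝ) (HiggsLattice.Site.tdist x₂ x : ℝ) / (P.L : ℝ) ^ j))) := by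
  set W : ℝ := (((HiggsLattice.Site.tdist x₁ x₂ : ℝ) / (P.L : ℝ) ^ j)⁻¹) ^ α with hW
  set X := Real.exp (-(δ / 2 * (min (HiggsLattice.Site.tdist x₁ x : ℝ) (HiggsLattice.Site.tdist x₂ x : ℝ) / (P.L : ℝ) ^ j)))
    with hX
  have hW0 : 0 ≤ W := Real.rpow_nonneg (inv_nonneg.mpr (by positivity)) _
  have hm0 : 0 < P.mesh 0 := P.mesh_pos 0
  have hmj : 0 < P.mesh j := P.mesh_pos j
  have hLj : (0 : ℝ) < (P.L : ℝ) ^ j := pow_pos (by exact_mod_cast P.hL) j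
  -- one colour: the sandwich engine with `cH := c_H·L^jε`, `cG := c₀(L^jε)²`, `cC := c₁(L^jε)²`
  have hsw : ∀ i' : Ix N, W * ‖hol C A x₁ Γ (covDeriv C A (pieceA C A msq a k j (cb P N 0 (x, i'))) ⟨x₂, μ⟩)
        - covDeriv C A (pieceA C A msq a k j (cb P N 0 (x, i'))) ⟨x₁, μ⟩‖
      ≤ coeff221 P a j ^ 2 * ((cH * P.mesh j * Real.exp δ * Real.sqrt N) * (c₀ * P.mesh j ^ 2 * Real.exp δ * Real.sqrt N) *
          (c₁ * P.mesh j ^ 2) * (((P.L : ℝ) ^ j) ^ P.d)⁻¹ * (2 * profile P N (δ / 2) ^ 2 * Real.exp (δ / 2)) * X) := by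
    intro i'
    rw [pieceA_of_pos hj1 hjk, termA, LinearMap.smul_apply, covDeriv_smul'', covDeriv_smul'', map_smul, ← smul_sub, norm_smul,
      Real.norm_eq_abs, abs_of_nonneg (sq_nonneg _), mul_left_comm]
    exact mul_le_mul_of_nonneg_left
      (holder_sandwich_cb_le C A msq a hjK (by positivity) (by positivity) (by positivity) hδ hG hH hC (x, i') μ hne hΓ)
      (sq_nonneg _)
  have hsum : W * ∑ i' : Ix N, ‖hol C A x₁ Γ (covDeriv C A (pieceA C A msq a k j (cb P N 0 (x, i'))) ⟨x₂, μ⟩)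
        - covDeriv C A (pieceA C A msq a k j (cb P N 0 (x, i'))) ⟨x₁, μ⟩‖
      ≤ N * (coeff221 P a j ^ 2 * ((cH * P.mesh j * Real.exp δ * Real.sqrt N) * (c₀ * P.mesh j ^ 2 * Real.exp δ * Real.sqrt N) *
          (c₁ * P.mesh j ^ 2) * (((P.L : ℝ) ^ j) ^ P.d)⁻¹ * (2 * profile P N (δ / 2) ^ 2 * Real.exp (δ / 2)) * X)) := by
    rw [Finset.mul_sum]
    refine (Finset.sum_le_sum fun i' _ => hsw i').trans ?_
    rw [Finset.sum_const, card_Ix, nsmul_eq_mul]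
  have hstep : W * holderTerm C A msq a k j μ x₁ x₂ x Γ
      = (P.mesh 0 ^ P.d)⁻¹ * (W * ∑ i' : Ix N, ‖hol C A x₁ Γ (covDeriv C A (pieceA C A msq a k j (cb P N 0 (x, i'))) ⟨x₂, μ⟩)
        - covDeriv C A (pieceA C A msq a k j (cb P N 0 (x, i'))) ⟨x₁, μ⟩‖) := by unfold holderTerm; ring
  rw [hstep]
  refine (mul_le_mul_of_nonneg_left hsum (inv_nonneg.mpr (pow_nonneg hm0.le _))).trans ?_
  rw [B1Eq243HiggsModel.coeff221_sq]
  have hre : (cH * P.mesh j * Real.exp δ * Real.sqrt N) * (c₀ * P.mesh j ^ 2 * Real.exp δ * Real.sqrt N)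
      = cH * c₀ * P.mesh j ^ 3 * Real.exp δ ^ 2 * N := by
    have h := Real.mul_self_sqrt (Nat.cast_nonneg N : (0 : ℝ) ≤ N)
    calc (cH * P.mesh j * Real.exp δ * Real.sqrt N) * (c₀ * P.mesh j ^ 2 * Real.exp δ * Real.sqrt N)
        = cH * c₀ * P.mesh j ^ 3 * Real.exp δ ^ 2 * (Real.sqrt N * Real.sqrt N) := by ring
      _ = _ := by rw [h]
  rw [hre]
  have hid : (P.mesh 0 ^ P.d)⁻¹ * (N * (B1.aSeq a (P.L : ℝ) j ^ 2 * (P.mesh j ^ 4)⁻¹ *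
        (cH * c₀ * P.mesh j ^ 3 * Real.exp δ ^ 2 * N * (c₁ * P.mesh j ^ 2) *
          (((P.L : ℝ) ^ j) ^ P.d)⁻¹ * (2 * profile P N (δ / 2) ^ 2 * Real.exp (δ / 2)) * X)))
      = B1.aSeq a (P.L : ℝ) j ^ 2 * (((N : ℝ) ^ 2 * a ^ 2 * (cH * c₀) * c₁ *
          (Real.exp δ ^ 2 * (2 * Real.exp (δ / 2)) * profile P N (δ / 2) ^ 2)) * (P.mesh j * (P.mesh j ^ P.d)⁻¹) * X) / a ^ 2 := by
    rw [eq_div_iff (pow_ne_zero 2 ha.ne')]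
    calc (P.mesh 0 ^ P.d)⁻¹ * (N * (B1.aSeq a (P.L : ℝ) j ^ 2 * (P.mesh j ^ 4)⁻¹ *
          (cH * c₀ * P.mesh j ^ 3 * Real.exp δ ^ 2 * N * (c₁ * P.mesh j ^ 2) *
            (((P.L : ℝ) ^ j) ^ P.d)⁻¹ * (2 * profile P N (δ / 2) ^ 2 * Real.exp (δ / 2)) * X))) * a ^ 2
        = B1.aSeq a (P.L : ℝ) j ^ 2 * (((N : ℝ) ^ 2 * a ^ 2 * (cH * c₀) * c₁ *
            (Real.exp δ ^ 2 * (2 * Real.exp (δ / 2)) * profile P N (δ / 2) ^ 2)) * X) *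
            ((P.mesh 0 ^ P.d)⁻¹ * (((P.L : ℝ) ^ j) ^ P.d)⁻¹) * ((P.mesh j ^ 4)⁻¹ * P.mesh j ^ (4 + 1)) := by ring
      _ = _ := by rw [inv_mesh_zero_pow_mul, mesh_pow_cancel, pow_one]; ring
  rw [hid, div_le_iff₀ (pow_pos ha 2)]
  have hrest : 0 ≤ ((N : ℝ) ^ 2 * a ^ 2 * (cH * c₀) * c₁ * (Real.exp δ ^ 2 * (2 * Real.exp (δ / 2)) * profile P N (δ / 2) ^ 2)) *
      (P.mesh j * (P.mesh j ^ P.d)⁻¹) * X := by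
    have hK : 0 ≤ profile P N (δ / 2) := profile_nonneg' _ (by linarith)
    positivity
  calc B1.aSeq a (P.L : ℝ) j ^ 2 * (((N : ℝ) ^ 2 * a ^ 2 * (cH * c₀) * c₁ *
          (Real.exp δ ^ 2 * (2 * Real.exp (δ / 2)) * profile P N (δ / 2) ^ 2)) * (P.mesh j * (P.mesh j ^ P.d)⁻¹) * X)
      ≤ a ^ 2 * (((N : ℝ) ^ 2 * a ^ 2 * (cH * c₀) * c₁ *
          (Real.exp δ ^ 2 * (2 * Real.exp (δ / 2)) * profile P N (δ / 2) ^ 2)) * (P.mesh j * (P.mesh j ^ P.d)⁻¹) * X) :=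
        mul_le_mul_of_nonneg_right (aSeq_sq_le ha hL1 hj1) hrest
    _ = _ := by ring

/-- **Pieces `j ≥ k`, `j ≥ 1` vanish** (no such terms in (2.6)): their Hölder terms are `0`. [cite: Balaban1983Higgs3, (2.6) p.424] -/
theorem holderTerm_eq_zero_of_le (hj1 : 1 ≤ j) (hkj : k ≤ j) (μ : Fin P.d) (x₁ x₂ x : HiggsLattice.Site P 0)
    (Γ : List (HiggsLattice.Site P 0)) : holderTerm C A msq a k j μ x₁ x₂ x Γ = 0 := by
  unfold holderTerm
  simp [pieceA_of_le hj1 hkj, covDeriv_zero'']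

end PieceBounds

/-! ## §3 The concrete carrier of B3 (2.10)–(2.11) at a regular non-constant background on the torus, with the Hölder fields -/

/-- **The concrete carrier of B3 (2.10)–(2.11) for `Ω = T_η` at a REGULAR NON-CONSTANT background `B̃ = A`**: p339501's
`regTorusKernels S C A m² a k` with the two (2.11) fields modelled — `holderDiff j μ x₁ x₂ x` = the supremum over the admissible
contours `Γ` from `x₁` to `x₂` (`IsAdm`) of `ε^{−d}Σ_{i′}‖U(A(Γ))(D^ε_{A,μ}G^η_{(j)}e_{(x,i′)})(⟨x₂,μ⟩) − (D^ε_{A,μ}G^η_{(j)}e_{(x,i′)})(⟨x₁,μ⟩)‖`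
(`holderTerm`), and `dist2 x₁ x₂ x = ε·min(|x₁ − x|, |x₂ − x|) = dist({x₁,x₂}, x)`; all other fields as `regTorusKernels` (so
(2.5)/(2.12) stay un-modelled). [cite: Balaban1983Higgs3, (2.6) p.424, (2.10)–(2.11) p.426] -/
def regTorusKernelsH (S : Shape P) (C : ChargeData N) (A : HiggsLattice.VecField P 0) (msq a : ℝ) (k : ℕ) : ScaledKernels :=
  { regTorusKernels S C A msq a k with
    dist2 := fun x₁ x₂ x => P.mesh 0 * min (HiggsLattice.Site.tdist x₁ x : ℝ) (HiggsLattice.Site.tdist x₂ x : ℝ)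
    holderDiff := fun j μ x₁ x₂ x =>
      ⨆ (Γ : List (HiggsLattice.Site P 0)) (_ : IsAdm x₁ x₂ Γ), holderTerm C A msq a k j μ x₁ x₂ x Γ }

section Carrier

variable {S : Shape P} {C : ChargeData N} {A : HiggsLattice.VecField P 0} {msq a : ℝ} {k : ℕ}

/-- (2.10) for the Hölder carrier IS (2.10) for p339501's `regTorusKernels` (same sites, distance, scales and kernels).
[cite: Balaban1983Higgs3, (2.10) p.426] -/
theorem ineq210_iff_H (δ₁ Cst : ℝ) :
    (regTorusKernelsH S C A msq a k).Ineq210 δ₁ Cst ↔ (regTorusKernels S C A msq a k).Ineq210 δ₁ Cst := Iff.rfl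

/-- the carrier's `L^jη` is the model's `L^jε`. [cite: Balaban1983Higgs3, (2.11) p.426] -/
theorem scaleH_eq (j : ℕ) : (regTorusKernelsH S C A msq a k).scale j = P.mesh j := by
  show (P.L : ℝ) ^ j * P.mesh 0 = P.mesh j
  rw [mesh_eq_pow_mul P j]

/-- the carrier's Hölder field. [cite: Balaban1983Higgs3, (2.11) p.426] -/
theorem regTorusKernelsH_holderDiff (j : ℕ) (μ : Fin P.d) (x₁ x₂ x : HiggsLattice.Site P 0) :
    (regTorusKernelsH S C A msq a k).holderDiff j μ x₁ x₂ x
      = ⨆ (Γ : List (HiggsLattice.Site P 0)) (_ : IsAdm x₁ x₂ Γ), holderTerm C A msq a k j μ x₁ x₂ x Γ := rfl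

/-- **Every admissible contour is dominated**: `holderTerm(Γ) ≤ holderDiff` for `Γ` admissible (the supremum is over a set bounded by
the contour-free bound `holderTerm_le_unif`). [cite: Balaban1983Higgs3, (2.11) p.426] -/
theorem holderTerm_le_holderDiff (j : ℕ) (μ : Fin P.d) (x₁ x₂ x : HiggsLattice.Site P 0) {Γ : List (HiggsLattice.Site P 0)}
    (hΓ : IsAdm x₁ x₂ Γ) :
    holderTerm C A msq a k j μ x₁ x₂ x Γ ≤ (regTorusKernelsH S C A msq a k).holderDiff j μ x₁ x₂ x := by
  rw [regTorusKernelsH_holderDiff]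
  set U : ℝ := (P.mesh 0 ^ P.d)⁻¹ * ∑ i' : Ix N,
      (‖covDeriv C A (pieceA C A msq a k j (cb P N 0 (x, i'))) ⟨x₂, μ⟩‖
        + ‖covDeriv C A (pieceA C A msq a k j (cb P N 0 (x, i'))) ⟨x₁, μ⟩‖) with hU
  have hU0 : 0 ≤ U := mul_nonneg (inv_nonneg.mpr (pow_nonneg (P.mesh_pos 0).le _)) (Finset.sum_nonneg fun _ _ => by positivity)
  have hbdd : BddAbove (Set.range fun Γ' : List (HiggsLattice.Site P 0) =>
      ⨆ (_ : IsAdm x₁ x₂ Γ'), holderTerm C A msq a k j μ x₁ x₂ x Γ') := by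
    refine ⟨U, ?_⟩
    rintro _ ⟨Γ', rfl⟩
    exact Real.iSup_le (fun _ => holderTerm_le_unif C A msq μ x₁ x₂ x Γ') hU0
  refine le_ciSup_of_le hbdd Γ ?_
  rw [ciSup_pos hΓ]

/-- kernel: `(L^jη)^{1−d−α} = (L^jη)·((L^jη)^d)^{−1}·((L^jη)^α)^{−1}` (real exponent). [folklore] -/
private theorem rpow_one_sub_sub (j : ℕ) (α : ℝ) :
    P.mesh j ^ ((1 : ℝ) - (P.d : ℝ) - α) = P.mesh j * (P.mesh j ^ P.d)⁻¹ * (P.mesh j ^ α)⁻¹ := by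
  have hs := P.mesh_pos j
  rw [Real.rpow_sub hs, Real.rpow_sub hs, Real.rpow_one, Real.rpow_natCast _ P.d, div_eq_mul_inv, div_eq_mul_inv]

/-- kernel: `(L^jη)^{−1}·(η·m) = m/L^j`. [folklore] -/
private theorem scale_inv_mul (j : ℕ) (m : ℝ) : (P.mesh j)⁻¹ * (P.mesh 0 * m) = m / (P.L : ℝ) ^ j := by
  rw [mesh_eq_pow_mul P j, mul_inv, mul_assoc, ← mul_assoc (P.mesh 0)⁻¹, inv_mul_cancel₀ (P.mesh_pos 0).ne', one_mul,
    div_eq_inv_mul]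

/-- kernel: the weights — `(ε·t)^α·((L^jε)^α)^{−1} = (t/L^j)^α`. [folklore] -/
private theorem weight_eq (j : ℕ) {t α : ℝ} (ht : 0 ≤ t) :
    (P.mesh 0 * t) ^ α * (P.mesh j ^ α)⁻¹ = (t / (P.L : ℝ) ^ j) ^ α := by
  have hm0 : 0 < P.mesh 0 := P.mesh_pos 0
  have hmj : 0 < P.mesh j := P.mesh_pos j
  rw [← Real.inv_rpow hmj.le, ← Real.mul_rpow (mul_nonneg hm0.le ht) (inv_nonneg.mpr hmj.le)]
  congr 1
  rw [mesh_eq_pow_mul P j, mul_inv, div_eq_mul_inv]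
  calc P.mesh 0 * t * (((P.L : ℝ) ^ j)⁻¹ * (P.mesh 0)⁻¹) = t * ((P.L : ℝ) ^ j)⁻¹ * (P.mesh 0 * (P.mesh 0)⁻¹) := by ring
    _ = t * ((P.L : ℝ) ^ j)⁻¹ := by rw [mul_inv_cancel₀ hm0.ne', mul_one]

/-- **Transfer**: Hölder-weighted bounds on every admissible contour's term, in the model's units, give `Ineq211At` for the carrier
(`holderDiff` is the supremum; `|x₁ − x₂| = ε·t`, `(t/L^j)^α/(ε t)^α = (L^jε)^{−α}`). [cite: Balaban1983Higgs3, (2.11) p.426] -/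
theorem ineq211At_of_bounds {α δ₁ Cst : ℝ} (hCst : 0 ≤ Cst)
    (h : ∀ (j : ℕ) (μ : Fin P.d) (x₁ x₂ x : HiggsLattice.Site P 0), x₂ ≠ x₁ → ∀ Γ : List (HiggsLattice.Site P 0), IsAdm x₁ x₂ Γ →
      (((HiggsLattice.Site.tdist x₁ x₂ : ℝ) / (P.L : ℝ) ^ j)⁻¹) ^ α * holderTerm C A msq a k j μ x₁ x₂ x Γ
        ≤ Cst * (P.mesh j * (P.mesh j ^ P.d)⁻¹) *
          Real.exp (-(δ₁ * (min (HiggsLattice.Site.tdist x₁ x : ℝ) (HiggsLattice.Site.tdist x₂ x : ℝ) / (P.L : ℝ) ^ j)))) :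
    (regTorusKernelsH S C A msq a k).Ineq211At α δ₁ Cst := by
  intro j μ x₁ x₂ x hne
  rw [scaleH_eq, regTorusKernelsH_holderDiff]
  show (⨆ (Γ : List (HiggsLattice.Site P 0)) (_ : IsAdm x₁ x₂ Γ), holderTerm C A msq a k j μ x₁ x₂ x Γ) /
      (P.mesh 0 * (HiggsLattice.Site.tdist x₁ x₂ : ℝ)) ^ α
    ≤ Cst * P.mesh j ^ ((1 : ℝ) - (P.d : ℝ) - α) *
      Real.exp (-(δ₁ * (P.mesh j)⁻¹ * (P.mesh 0 * min (HiggsLattice.Site.tdist x₁ x : ℝ) (HiggsLattice.Site.tdist x₂ x : ℝ))))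
  set t : ℝ := (HiggsLattice.Site.tdist x₁ x₂ : ℝ) with ht
  set E : ℝ := Real.exp (-(δ₁ * (min (HiggsLattice.Site.tdist x₁ x : ℝ) (HiggsLattice.Site.tdist x₂ x : ℝ) / (P.L : ℝ) ^ j)))
    with hE
  have hm0 : 0 < P.mesh 0 := P.mesh_pos 0
  have hmj : 0 < P.mesh j := P.mesh_pos j
  have hLj : (0 : ℝ) < (P.L : ℝ) ^ j := pow_pos (by exact_mod_cast P.hL) j
  have ht1 : 1 ≤ t := by rw [ht]; exact_mod_cast one_le_tdist_of_ne' hne.symm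
  have ht0 : 0 < t := by linarith
  have hu : 0 < t / (P.L : ℝ) ^ j := div_pos ht0 hLj
  have hdist : 0 < (P.mesh 0 * t) ^ α := Real.rpow_pos_of_pos (mul_pos hm0 ht0) _
  have hexp : Real.exp (-(δ₁ * (P.mesh j)⁻¹ * (P.mesh 0 * min (HiggsLattice.Site.tdist x₁ x : ℝ) (HiggsLattice.Site.tdist x₂ x : ℝ))))
      = E := by
    rw [hE, mul_assoc δ₁, scale_inv_mul]
  rw [hexp, div_le_iff₀ hdist]
  -- the right side in the model's units: `Cst·(L^jε)(L^jε)^{−d}·E·(t/L^j)^α`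
  have hrhs : Cst * P.mesh j ^ ((1 : ℝ) - (P.d : ℝ) - α) * E * (P.mesh 0 * t) ^ α
      = Cst * (P.mesh j * (P.mesh j ^ P.d)⁻¹) * E * (t / (P.L : ℝ) ^ j) ^ α := by
    rw [rpow_one_sub_sub, ← weight_eq j ht0.le]; ring
  rw [hrhs]
  have hB0 : 0 ≤ Cst * (P.mesh j * (P.mesh j ^ P.d)⁻¹) * E * (t / (P.L : ℝ) ^ j) ^ α := by positivity
  refine Real.iSup_le (fun Γ => Real.iSup_le (fun hΓ => ?_) hB0) hB0
  -- one admissible contour: divide the weighted bound by the weight `W = ((t/L^j)^α)^{−1}`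
  have hW : (((t / (P.L : ℝ) ^ j))⁻¹) ^ α = ((t / (P.L : ℝ) ^ j) ^ α)⁻¹ := Real.inv_rpow hu.le α
  have hWpos : 0 < (t / (P.L : ℝ) ^ j) ^ α := Real.rpow_pos_of_pos hu _
  have hh := h j μ x₁ x₂ x hne.symm Γ hΓ
  rw [← ht, hW, ← hE, inv_mul_le_iff₀ hWpos] at hh
  calc holderTerm C A msq a k j μ x₁ x₂ x Γ ≤ (t / (P.L : ℝ) ^ j) ^ α * (Cst * (P.mesh j * (P.mesh j ^ P.d)⁻¹) * E) := hh
    _ = _ := by ring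

end Carrier

/-- **The constant `O(1)` of (2.11)** assembled from the constants of (I.2.24) (`c_H`, Hölder), (I.2.25) (`c₀`, value) and (I.2.34)
(`c₁`), the common decay rate `δ`, `N`, `a`, `L`, `d` (through the lattice-sum profile `K = N·K_d`). [cite: Balaban1983Higgs3, (2.11) p.426] -/
def cst211 (d L N : ℕ) (a c₀ cH c₁ δ : ℝ) : ℝ :=
  1 + (N : ℝ) * Real.sqrt N * cH * (L : ℝ) +
    (N : ℝ) ^ 2 * a ^ 2 * (cH * c₀) * c₁ *
      (Real.exp δ ^ 2 * (2 * Real.exp (δ / 2)) * ((nCol N : ℝ) * B4Sect5Proof.latticeConst d (δ / 2)) ^ 2)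

section Constant

variable {d L N : ℕ} {a c₀ cH c₁ δ : ℝ}

/-- the two summands of `cst211` are nonnegative. [cite: Balaban1983Higgs3, (2.11) p.426] -/
private theorem cst211_summands_nonneg (hc₀ : 0 ≤ c₀) (hcH : 0 ≤ cH) (hc₁ : 0 ≤ c₁) :
    0 ≤ (N : ℝ) * Real.sqrt N * cH * (L : ℝ) ∧
    0 ≤ (N : ℝ) ^ 2 * a ^ 2 * (cH * c₀) * c₁ *
      (Real.exp δ ^ 2 * (2 * Real.exp (δ / 2)) * ((nCol N : ℝ) * B4Sect5Proof.latticeConst d (δ / 2)) ^ 2) :=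
  ⟨by positivity, by positivity⟩

/-- `cst211 > 0`. [cite: Balaban1983Higgs3, (2.11) p.426] -/
theorem cst211_pos (hc₀ : 0 ≤ c₀) (hcH : 0 ≤ cH) (hc₁ : 0 ≤ c₁) : 0 < cst211 d L N a c₀ cH c₁ δ := by
  obtain ⟨h1, h2⟩ := cst211_summands_nonneg (d := d) (L := L) (N := N) (a := a) (δ := δ) hc₀ hcH hc₁
  unfold cst211; linarith

/-- `N√N·c_H·L ≤ cst211`. [cite: Balaban1983Higgs3, (2.11) p.426] -/
theorem le_cst211_zero (hc₀ : 0 ≤ c₀) (hcH : 0 ≤ cH) (hc₁ : 0 ≤ c₁) :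
    (N : ℝ) * Real.sqrt N * cH * (L : ℝ) ≤ cst211 d L N a c₀ cH c₁ δ := by
  obtain ⟨h1, h2⟩ := cst211_summands_nonneg (d := d) (L := L) (N := N) (a := a) (δ := δ) hc₀ hcH hc₁
  unfold cst211; linarith

/-- `N²a²(c_Hc₀)c₁·e^{2δ}(2e^{δ/2})K(δ/2)² ≤ cst211`. [cite: Balaban1983Higgs3, (2.11) p.426] -/
theorem le_cst211_pos (hc₀ : 0 ≤ c₀) (hcH : 0 ≤ cH) (hc₁ : 0 ≤ c₁) :
    (N : ℝ) ^ 2 * a ^ 2 * (cH * c₀) * c₁ *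
      (Real.exp δ ^ 2 * (2 * Real.exp (δ / 2)) * ((nCol N : ℝ) * B4Sect5Proof.latticeConst d (δ / 2)) ^ 2)
      ≤ cst211 d L N a c₀ cH c₁ δ := by
  obtain ⟨h1, h2⟩ := cst211_summands_nonneg (d := d) (L := L) (N := N) (a := a) (δ := δ) hc₀ hcH hc₁
  unfold cst211; linarith

end Constant

/-! ## §4 (2.11) PROVED for the carrier at every fixed Hölder exponent: regular non-constant background, `Ω = T_η`, uniformly in the volume -/

section Main

/-- weakening in the exponent: `e^{−u} ≤ e^{−v}` when `v ≤ u`. [folklore] -/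
private theorem exp_le_exp_of_le {u v : ℝ} (h : v ≤ u) : Real.exp (-u) ≤ Real.exp (-v) :=
  Real.exp_le_exp.mpr (neg_le_neg h)

/-- **B3 (2.11) p. 426 [PDF 16] PROVED AT A REGULAR NON-CONSTANT BACKGROUND `B̃ = A` ON THE TORUS `Ω = T_η`, at every fixed Hölder
exponent, uniformly in the volume.**  For `d, L` (`L` odd `> 1`), `a > 0`, `m² > 0`, `N`, charge data `C = (e, U)` there is a threshold
`K₀,min` (chosen BEFORE `α`) and, for every `0 ≤ α < 1` and every cube size `K₀`, constants `t(K₀), δ₁(K₀), C(K₀) > 0` (depending on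
`α`) such that: for every `K₀ ≥ K₀,min`, every volume `P` of the (Higgs)₂,₃ torus family with these `d, L` (`S : Shape P`) tiled by
`K₀`-cubes (`K₀ ∣ M`, `3K₀ ≤ 2M`), every scale `1 ≤ k ≤ K` with `L^kε ≤ 1`, and every `δ_A`-REGULAR configuration `A` on `T_ε`
(`|A(⟨z + e_ν, μ⟩) − A(⟨z, μ⟩)| ≤ δ_A`) with the smallness `L^k·δ_A·|e| ≤ t(K₀)`:
`(regTorusKernelsH S C A msq a k).Ineq211At α (δ₁ K₀) (C K₀)`, i.e. for all `j`, `μ`, `x₁ ≠ x₂`, `x ∈ T_η`: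
`sup_{Γ adm.} ε^{−d}Σ_{i′}‖U(A(Γ))(D^ε_{A,μ}G^η_{(j)}e_{(x,i′)})(x₂) − (D^ε_{A,μ}G^η_{(j)}e_{(x,i′)})(x₁)‖ / |x₁ − x₂|^α
≤ C(L^jη)^{1−d−α}e^{−δ₁(L^jη)^{−1}dist({x₁,x₂},x)}`.
Print: *"This applies also to Hölder norms, e.g. we have (2.11), 0 ≤ α < 1. … They all are obtained by rescaling from the η-lattice
to the L^{−j}-lattice and application of Propositions I.2.1 and I.2.3."*  Route: exactly that — the pieces (2.6) are the terms of
(I.2.43) at `A` (p339501's `pieceA`); in each term `a_j²(L^jε)^{−4}G^ε_jQ_j^*C^{(j)}Q_jG^ε_j` the transported Hölder difference falls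
on the first factor and is bounded through Proposition I.2.1 (2.24) at a regular `A` on the torus
(`B1Ineq224RegularTorus.norm_holder_propagatorK_reg_decay`, per-α constants), the other factors through (I.2.25)
(`B1Ineq225RegularTorus.norm_propagatorK_reg_decay`, adjointness `(Q_jG^ε_j)^* = G^ε_jQ_j^*`) and (I.2.34)
(`B1Props21to23RegularTorus.ineq234_236_regular_torus_std`), the three-kernel convolution on `T^{(j)}` from `x₁` and from `x₂`;
the piece `G^η_{(0)} = G^ε_1` is (2.24) at level `1`.  Honest scope: torus only (`Ω = T_η`); `m² > 0`; the `Shape` sub-family and the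
cube tiling of the cited torus theorems; constants depend on `α` and on `K₀` (as in the cited inputs; GAPS G-B3-11); `holderDiff` is the
supremum over the admissible contours `|Γ| ≤ d·|x₁ − x₂|`.
[cite: Balaban1983Higgs3, (2.6) p.424, (2.11) p.426] [cite: Balaban1982Higgs1, Prop. 2.1 (2.24)–(2.25) p.610, Prop. 2.3 (2.34) p.611, (2.43) p.612] -/
theorem ineq211At_regularTorus (d L : ℕ) (hL : Odd L ∧ 1 < L) {a : ℝ} (ha : 0 < a) {msq : ℝ} (hmsq : 0 < msq)
    (N : ℕ) (C : ChargeData N) :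
    ∃ K₀min : ℕ, ∀ {α : ℝ}, 0 ≤ α → α < 1 →
      ∃ t δ₁ Cst : ℕ → ℝ, (∀ K₀, 0 < t K₀ ∧ 0 < δ₁ K₀ ∧ 0 < Cst K₀) ∧
      ∀ K₀ : ℕ, K₀min ≤ K₀ →
      ∀ (P : HiggsLattice.Params) (S : Shape P), P.d = d → P.L = L → K₀ ∣ P.M → 3 * K₀ ≤ 2 * P.M →
      ∀ {k : ℕ}, 1 ≤ k → k ≤ P.K → P.mesh k ≤ 1 →
      ∀ (A : HiggsLattice.VecField P 0) {δA : ℝ}, 0 ≤ δA →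
        (∀ (z : HiggsLattice.Site P 0) (μ ν : Fin P.d), |A ⟨z.shift ν, μ⟩ - A ⟨z, μ⟩| ≤ δA) →
        (P.L : ℝ) ^ k * δA * |C.e| ≤ t K₀ →
        (regTorusKernelsH S C A msq a k).Ineq211At α (δ₁ K₀) (Cst K₀) := by
  have hL2 : 2 ≤ L := hL.2
  obtain ⟨c₀, hc₀, K₁, e₁, ρ₁, hpos₁, hV⟩ :=
    B1Ineq225RegularTorus.norm_propagatorK_reg_decay d L hL2 ha hmsq N C 1 1 1 zero_le_one one_pos
  obtain ⟨K₃, tA, c₁, ρ₃, hpos₃, hCov⟩ := B1Props21to23RegularTorus.ineq234_236_regular_torus_std d L hL ha hmsq N C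
  obtain ⟨K₄, hHol⟩ := B1Ineq224RegularTorus.norm_holder_propagatorK_reg_decay d L hL2 ha hmsq N C 1 1 1 zero_le_one one_pos
  have hLpos : (0 : ℝ) < L := by exact_mod_cast (by omega : 0 < L)
  refine ⟨max K₁ (max K₃ K₄), fun {α} hα0 hα1 => ?_⟩
  obtain ⟨cH, hcH, eH, ρH, hposH, hH⟩ := hHol hα0 hα1
  -- the common decay rate of the three inputs
  obtain ⟨δ, hδ⟩ : ∃ δ : ℕ → ℝ, ∀ K₀, δ K₀ = min (ρ₁ K₀) (min (ρ₃ K₀) (ρH K₀)) := ⟨_, fun _ => rfl⟩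
  have hδpos : ∀ K₀, 0 < δ K₀ := fun K₀ => by
    rw [hδ]; exact lt_min (hpos₁ K₀).2 (lt_min (hpos₃ K₀).2.2 (hposH K₀).2)
  refine ⟨fun K₀ => min (tA K₀) (min (e₁ K₀) (eH K₀)), fun K₀ => δ K₀ / (2 * L),
    fun K₀ => cst211 d L N a c₀ cH (c₁ K₀) (δ K₀), fun K₀ => ⟨?_, ?_, ?_⟩, ?_⟩
  · exact lt_min (hpos₃ K₀).1 (lt_min (hpos₁ K₀).1 (hposH K₀).1)
  · exact div_pos (hδpos K₀) (by positivity)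
  · exact cst211_pos hc₀.le hcH.le (hpos₃ K₀).2.1.le
  intro K₀ hK₀ P S hPd hPL hK₀M h3M k hk1 hkK hmesh A δA hδA hreg ht
  have hK₁ : K₁ ≤ K₀ := (le_max_left _ _).trans hK₀
  have hK₃ : K₃ ≤ K₀ := ((le_max_left _ _).trans (le_max_right _ _)).trans hK₀
  have hK₄ : K₄ ≤ K₀ := ((le_max_right _ _).trans (le_max_right _ _)).trans hK₀
  subst hPd hPL
  have hL1 : 1 < P.L := hL.2
  have hLge1 : (1 : ℝ) ≤ P.L := by exact_mod_cast P.hL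
  have hc₁ : 0 ≤ c₁ K₀ := (hpos₃ K₀).2.1.le
  have hδK : 0 < δ K₀ := hδpos K₀
  have hδ₁ : δ K₀ ≤ ρ₁ K₀ := by rw [hδ]; exact min_le_left _ _
  have hδ₃ : δ K₀ ≤ ρ₃ K₀ := by rw [hδ]; exact (min_le_right _ _).trans (min_le_left _ _)
  have hδH : δ K₀ ≤ ρH K₀ := by rw [hδ]; exact (min_le_right _ _).trans (min_le_right _ _)
  have htA : (P.L : ℝ) ^ k * δA * |C.e| ≤ tA K₀ := ht.trans (min_le_left _ _)
  have hte₁ : (P.L : ℝ) ^ k * δA * |C.e| ≤ e₁ K₀ := ht.trans ((min_le_right _ _).trans (min_le_left _ _))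
  have hteH : (P.L : ℝ) ^ k * δA * |C.e| ≤ eH K₀ := ht.trans ((min_le_right _ _).trans (min_le_right _ _))
  have hCst : 0 ≤ cst211 P.d P.L N a c₀ cH (c₁ K₀) (δ K₀) := (cst211_pos hc₀.le hcH.le hc₁).le
  -- the three inputs at every level `1 ≤ l ≤ k`, in the engine's form with the common rate `δ K₀`
  have hGl : ∀ {l : ℕ}, 1 ≤ l → l ≤ k → ∀ (g : ScalarField P 0 N) (M D : ℝ), (∀ x, ‖g x‖ ≤ M) → 0 ≤ D →
      ∀ x, (∀ z, g z ≠ 0 → D ≤ (HiggsLattice.Site.tdist x z : ℝ)) →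
        ‖propagatorK C Finset.univ A msq a l g x‖ ≤ c₀ * P.mesh l ^ 2 * Real.exp (-(δ K₀ * (D / (P.L : ℝ) ^ l))) * M := by
    intro l hl1 hlk g M D hg hD0 x hsupp
    have hmesh_l : P.mesh l ≤ 1 := (mesh_mono P hlk).trans hmesh
    have h := hV K₀ hK₁ P rfl rfl hK₀M h3M hl1 (hlk.trans hkK) hmesh_l A (hpos₁ K₀).1 le_rfl
      (reg223_of_small C A hlk hmesh_l (hpos₁ K₀).1 hδA hreg hte₁ le_rfl) g M D hg hD0 x hsupp
    refine h.trans ?_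
    have hM : 0 ≤ M := (norm_nonneg _).trans (hg x)
    have hexp := exp_rate_mono hδ₁ (show (0 : ℝ) ≤ D / (P.L : ℝ) ^ l by positivity)
    exact mul_le_mul_of_nonneg_right (mul_le_mul_of_nonneg_left hexp (by positivity)) hM
  have hHl : ∀ {l : ℕ}, 1 ≤ l → l ≤ k → ∀ (g : ScalarField P 0 N) (M D : ℝ), (∀ x, ‖g x‖ ≤ M) → 0 ≤ D →
      ∀ (μ : Fin P.d) (x x' : HiggsLattice.Site P 0), x' ≠ x → ∀ Γ : List (HiggsLattice.Site P 0), IsTChain x Γ →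
        pathEnd x Γ = x' → (Γ.length : ℝ) ≤ (P.d : ℝ) * HiggsLattice.Site.tdist x x' →
        (∀ z, g z ≠ 0 → D ≤ (HiggsLattice.Site.tdist x z : ℝ)) → (∀ z, g z ≠ 0 → D ≤ (HiggsLattice.Site.tdist x' z : ℝ)) →
          (((HiggsLattice.Site.tdist x x' : ℝ) / (P.L : ℝ) ^ l)⁻¹) ^ α *
              ‖hol C A x Γ (covDeriv C A (propagatorK C Finset.univ A msq a l g) ⟨x', μ⟩)
                - covDeriv C A (propagatorK C Finset.univ A msq a l g) ⟨x, μ⟩‖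
            ≤ cH * P.mesh l * Real.exp (-(δ K₀ * (D / (P.L : ℝ) ^ l))) * M := by
    intro l hl1 hlk g M D hg hD0 μ x x' hne Γ hch hend hlen hDx hDx'
    have hmesh_l : P.mesh l ≤ 1 := (mesh_mono P hlk).trans hmesh
    have h := hH K₀ hK₄ P rfl rfl hK₀M h3M hl1 (hlk.trans hkK) hmesh_l A (hposH K₀).1 le_rfl
      (reg223_of_small C A hlk hmesh_l (hposH K₀).1 hδA hreg hteH le_rfl) g M D hg hD0 μ x x' hne Γ hch hend hlen hDx hDx'
    refine h.trans ?_
    have hM : 0 ≤ M := (norm_nonneg _).trans (hg x)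
    have hml : 0 < P.mesh l := P.mesh_pos l
    have hexp := exp_rate_mono hδH (show (0 : ℝ) ≤ D / (P.L : ℝ) ^ l by positivity)
    exact mul_le_mul_of_nonneg_right (mul_le_mul_of_nonneg_left hexp (by positivity)) hM
  have hCl : ∀ {l : ℕ}, 1 ≤ l → l < k → ∀ s t : HiggsLattice.Site P l × Ix N,
      |mat (fluctCovA C Finset.univ A msq a l) s t|
        ≤ c₁ K₀ * P.mesh l ^ 2 * Real.exp (-(δ K₀ * (HiggsLattice.Site.tdist s.1 t.1 : ℝ))) := by
    intro l hl1 hlk s t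
    have hmesh_l : P.mesh l ≤ 1 := (mesh_mono P hlk.le).trans hmesh
    have htl : (P.L : ℝ) ^ l * δA * |C.e| ≤ tA K₀ := by
      have hpow : (P.L : ℝ) ^ l ≤ (P.L : ℝ) ^ k := pow_le_pow_right₀ hLge1 hlk.le
      have h0 : 0 ≤ δA * |C.e| := mul_nonneg hδA (abs_nonneg _)
      nlinarith
    have h := (hCov K₀ hK₃ P S rfl rfl hK₀M h3M hl1 (lt_of_lt_of_le hlk hkK) hmesh_l A hδA hreg htl Finset.univ
      (p := s) (q := t) (Finset.mem_univ _) (Finset.mem_univ _)).1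
    rw [HiggsCondCov232.condCov232_univ] at h
    refine h.trans ?_
    have hexp := exp_rate_mono hδ₃ (Nat.cast_nonneg _ : (0 : ℝ) ≤ (HiggsLattice.Site.tdist s.1 t.1 : ℝ))
    calc P.mesh l ^ 2 * c₁ K₀ * Real.exp (-(ρ₃ K₀ * (HiggsLattice.Site.tdist s.1 t.1 : ℝ)))
        ≤ P.mesh l ^ 2 * c₁ K₀ * Real.exp (-(δ K₀ * (HiggsLattice.Site.tdist s.1 t.1 : ℝ))) :=
          mul_le_mul_of_nonneg_left hexp (by positivity)
      _ = _ := by ring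
  -- rate bookkeeping: `δ/(2L) ≤ δ/2` and the `j = 0` exponent (rate `δ` at level `1` beats rate `δ/(2L)` at level `0`)
  have hrate : δ K₀ / (2 * P.L) ≤ δ K₀ / 2 := by
    rw [div_le_div_iff₀ (by positivity) (by norm_num : (0 : ℝ) < 2)]
    nlinarith
  have hexp0 : ∀ m : ℝ, 0 ≤ m →
      Real.exp (-(δ K₀ * (m / (P.L : ℝ) ^ 1))) ≤ Real.exp (-(δ K₀ / (2 * P.L) * (m / (P.L : ℝ) ^ 0))) := by
    intro m hm
    apply exp_le_exp_of_le
    rw [pow_one, pow_zero, div_one]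
    have h0 : 0 ≤ δ K₀ * (m / P.L) := by positivity
    calc δ K₀ / (2 * P.L) * m = (1 / 2) * (δ K₀ * (m / P.L)) := by ring
      _ ≤ δ K₀ * (m / P.L) := by linarith
  have hexpj : ∀ (j : ℕ) (m : ℝ), 0 ≤ m →
      Real.exp (-(δ K₀ / 2 * (m / (P.L : ℝ) ^ j))) ≤ Real.exp (-(δ K₀ / (2 * P.L) * (m / (P.L : ℝ) ^ j))) :=
    fun j m hm => exp_rate_mono hrate (by positivity)
  refine ineq211At_of_bounds hCst (fun j μ x₁ x₂ x hne Γ hΓ => ?_)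
  have hmj : 0 < P.mesh j := P.mesh_pos j
  have hmin : 0 ≤ min (HiggsLattice.Site.tdist x₁ x : ℝ) (HiggsLattice.Site.tdist x₂ x : ℝ) :=
    le_min (Nat.cast_nonneg _) (Nat.cast_nonneg _)
  rcases Nat.eq_zero_or_pos j with rfl | hj1
  · -- the piece `G^η_{(0)} = G^ε_1`: (I.2.24) at level `1`
    refine (holder_piece_zero_le C A msq (k := k) hα0 (hHl le_rfl hk1) μ hne x hΓ).trans ?_
    exact mul_le_mul (mul_le_mul_of_nonneg_right (le_cst211_zero hc₀.le hcH.le hc₁) (by positivity)) (hexp0 _ hmin)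
      (Real.exp_pos _).le (by positivity)
  · by_cases hjk : j < k
    · refine (holder_piece_pos_le C A msq ha hL1 hj1 hjk (hjk.le.trans hkK) hc₀.le hcH.le hc₁ hδK (hGl hj1 hjk.le)
        (hHl hj1 hjk.le) (hCl hj1 hjk) μ hne x hΓ).trans ?_
      exact mul_le_mul (mul_le_mul_of_nonneg_right (le_cst211_pos hc₀.le hcH.le hc₁) (by positivity)) (hexpj j _ hmin)
        (Real.exp_pos _).le (by positivity)
    · rw [holderTerm_eq_zero_of_le C A msq hj1 (not_lt.mp hjk), mul_zero]
      positivity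

/-- **(2.10) and (2.11) on the SAME carrier**: under the hypotheses of both theorems (the threshold and the smallness `t` taken for
both), `regTorusKernelsH` satisfies p339501's (2.10) (through `ineq210_iff_H`) and (2.11) at the fixed exponent `α`.
[cite: Balaban1983Higgs3, (2.10)–(2.11) p.426] -/
theorem ineq210_and_211At_regularTorusH (d L : ℕ) (hL : Odd L ∧ 1 < L) {a : ℝ} (ha : 0 < a) {msq : ℝ} (hmsq : 0 < msq)
    (N : ℕ) (C : ChargeData N) :
    ∃ K₀min : ℕ, ∀ {α : ℝ}, 0 ≤ α → α < 1 →
      ∃ t δ₁ Cst : ℕ → ℝ, (∀ K₀, 0 < t K₀ ∧ 0 < δ₁ K₀ ∧ 0 < Cst K₀) ∧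
      ∀ K₀ : ℕ, K₀min ≤ K₀ →
      ∀ (P : HiggsLattice.Params) (S : Shape P), P.d = d → P.L = L → K₀ ∣ P.M → 3 * K₀ ≤ 2 * P.M →
      ∀ {k : ℕ}, 1 ≤ k → k ≤ P.K → P.mesh k ≤ 1 →
      ∀ (A : HiggsLattice.VecField P 0) {δA : ℝ}, 0 ≤ δA →
        (∀ (z : HiggsLattice.Site P 0) (μ ν : Fin P.d), |A ⟨z.shift ν, μ⟩ - A ⟨z, μ⟩| ≤ δA) →
        (P.L : ℝ) ^ k * δA * |C.e| ≤ t K₀ →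
        (regTorusKernelsH S C A msq a k).Ineq210 (δ₁ K₀) (Cst K₀) ∧
          (regTorusKernelsH S C A msq a k).Ineq211At α (δ₁ K₀) (Cst K₀) := by
  obtain ⟨K₁, t₁, δ₁, C₁, hpos₁, h₁⟩ := ineq210_regularTorus d L hL ha hmsq N C
  obtain ⟨K₂, h₂⟩ := ineq211At_regularTorus d L hL ha hmsq N C
  refine ⟨max K₁ K₂, fun {α} hα0 hα1 => ?_⟩
  obtain ⟨t₂, δ₂, C₂, hpos₂, h₂'⟩ := h₂ hα0 hα1
  refine ⟨fun K₀ => min (t₁ K₀) (t₂ K₀), fun K₀ => min (δ₁ K₀) (δ₂ K₀), fun K₀ => max (C₁ K₀) (C₂ K₀),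
    fun K₀ => ⟨lt_min (hpos₁ K₀).1 (hpos₂ K₀).1, lt_min (hpos₁ K₀).2.1 (hpos₂ K₀).2.1,
      lt_max_of_lt_left (hpos₁ K₀).2.2⟩, ?_⟩
  intro K₀ hK₀ P S hPd hPL hK₀M h3M k hk1 hkK hmesh A δA hδA hreg ht
  have hA := h₁ K₀ ((le_max_left _ _).trans hK₀) P S hPd hPL hK₀M h3M hk1 hkK hmesh A hδA hreg (ht.trans (min_le_left _ _))
  have hB := h₂' K₀ ((le_max_right _ _).trans hK₀) P S hPd hPL hK₀M h3M hk1 hkK hmesh A hδA hreg (ht.trans (min_le_right _ _))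
  -- weakening of the constants: a smaller rate and a larger constant preserve both displays
  have hscale : ∀ j, 0 < (regTorusKernelsH S C A msq a k).scale j := fun j => by rw [scaleH_eq]; exact P.mesh_pos j
  refine ⟨?_, ?_⟩
  · rw [ineq210_iff_H]
    intro j x x'
    obtain ⟨hv, hd⟩ := hA j x x'
    have hs : 0 < (regTorusKernels S C A msq a k).scale j := hscale j
    have hdist : 0 ≤ (regTorusKernels S C A msq a k).dist x x' := by
      rw [regTorusKernels_dist]; exact mul_nonneg (P.mesh_pos 0).le (Nat.cast_nonneg _)
    have hexp : Real.exp (-(δ₁ K₀ * ((regTorusKernels S C A msq a k).scale j)⁻¹ * (regTorusKernels S C A msq a k).dist x x'))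
        ≤ Real.exp (-(min (δ₁ K₀) (δ₂ K₀) * ((regTorusKernels S C A msq a k).scale j)⁻¹ *
          (regTorusKernels S C A msq a k).dist x x')) := by
      rw [mul_assoc, mul_assoc]
      exact exp_rate_mono (min_le_left _ _) (mul_nonneg (inv_nonneg.mpr hs.le) hdist)
    refine ⟨hv.trans ?_, fun μ => (hd μ).trans ?_⟩
    · exact mul_le_mul (mul_le_mul_of_nonneg_right (le_max_left _ _) (Real.rpow_nonneg hs.le _)) hexp
        (Real.exp_pos _).le (mul_nonneg (le_trans (hpos₁ K₀).2.2.le (le_max_left _ _)) (Real.rpow_nonneg hs.le _))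
    · exact mul_le_mul (mul_le_mul_of_nonneg_right (le_max_left _ _) (Real.rpow_nonneg hs.le _)) hexp
        (Real.exp_pos _).le (mul_nonneg (le_trans (hpos₁ K₀).2.2.le (le_max_left _ _)) (Real.rpow_nonneg hs.le _))
  · intro j μ x₁ x₂ x hne
    have h := hB j μ x₁ x₂ x hne
    have hs : 0 < (regTorusKernelsH S C A msq a k).scale j := hscale j
    have hdist2 : 0 ≤ (regTorusKernelsH S C A msq a k).dist2 x₁ x₂ x := by
      show 0 ≤ P.mesh 0 * min (HiggsLattice.Site.tdist x₁ x : ℝ) (HiggsLattice.Site.tdist x₂ x : ℝ)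
      exact mul_nonneg (P.mesh_pos 0).le (le_min (Nat.cast_nonneg _) (Nat.cast_nonneg _))
    have hexp : Real.exp (-(δ₂ K₀ * ((regTorusKernelsH S C A msq a k).scale j)⁻¹ * (regTorusKernelsH S C A msq a k).dist2 x₁ x₂ x))
        ≤ Real.exp (-(min (δ₁ K₀) (δ₂ K₀) * ((regTorusKernelsH S C A msq a k).scale j)⁻¹ *
          (regTorusKernelsH S C A msq a k).dist2 x₁ x₂ x)) := by
      rw [mul_assoc, mul_assoc]
      exact exp_rate_mono (min_le_right _ _) (mul_nonneg (inv_nonneg.mpr hs.le) hdist2)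
    refine h.trans ?_
    exact mul_le_mul (mul_le_mul_of_nonneg_right (le_max_right _ _) (Real.rpow_nonneg hs.le _)) hexp
      (Real.exp_pos _).le (mul_nonneg (le_trans (hpos₂ K₀).2.2.le (le_max_right _ _)) (Real.rpow_nonneg hs.le _))

end Main

end Literature.MathematicalPhysics.QuantumFieldTheory.Balaban1983to89.B3Ineq211RegularTorus

end
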